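import Literature.NumberTheory.EllipticCurves.IsogenyQuotientPlacesProofs
import Literature.NumberTheory.EllipticCurves.IsogenyQuotientProofs
import Literature.NumberTheory.EllipticCurves.SingularCubic
import HarnessLib

/-!
# The quotient isogeny `E → E/S` (Silverman, *AEC*, Prop. III.4.12): construction and proof

Trunk T-ELLARITH (group G16); notion `cm_endomorphisms_isogeny`. This file **discharges** the named
facts `WeierstrassCurve.exists_separable_isogeny_ker_eq` (`IsogenyQuotientProofs`) and, through
the tree's reduction `exists_isogeny_ker_eq_and_comp_eq_nsmul_of_separable_quotient`, the quotient +
dual package `WeierstrassCurve.exists_isogeny_ker_eq_and_comp_eq_nsmul` (`IsogenyQuotient`) — the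
geometric input `hquot` of Tate's theorem for elliptic curves over finite fields
(`Literature.AlgebraicGeometry.Motives.FaltingsECTateMainTheoremProofs`, Tate 1966) and of the
reduction of Faltings' semisimplicity for elliptic curves
(`FaltingsECSemisimpleNumberFieldProofs`):

* `WeierstrassCurve.exists_separable_isogeny_ker_eq_holds`: for `K` perfect, `E = W` elliptic and
  `S ⊆ E(K̄)` a finite `Γ_K`-stable subgroup, there are an elliptic curve `E' = E/S` over `K` and
  an isogeny `φ : E → E'` over `K` (a term of the prelude structure `WeierstrassCurve.Isogeny`)
  with `ker φ = S` and `deg φ = [K̄(E) : φ^* K̄(E')] = #S` (Silverman, *AEC*, Prop. III.4.12,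
  Rem. III.4.13.2, Thm. III.4.10(a) and (c));
* `WeierstrassCurve.exists_isogeny_ker_eq_and_comp_eq_nsmul_holds` (with the dual, Thm. III.6.1(a)).

## The construction (a proof of Prop. III.4.12 through the fixed field `K̄(E)^S`)

Silverman constructs `E/Φ` as the curve with function field `K̄(E)^Φ` (proof of III.4.12: "a
smooth curve `C` and a finite separable morphism `E → C` with `φ^* K̄(C) = K̄(E)^Φ`", then
`C` has genus one by Hurwitz and is made an elliptic curve). Here, with the translations
`τ_s^*` of `FunctionFieldTranslation` and the theory of zeros and poles of the tree
(`WeierstrassPlaces`, `WeilPairingDivisors`, `FunctionFieldLPoints`,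
`IsogenyQuotientPlacesProofs`), everything is made explicit on the Weierstrass model:

* **Step A** (`trX`, `trY`): the traces `x_S = Σ_{s∈S} τ_s^* x`, `y_S = Σ_s τ_s^* y ∈ K̄(E)^S`
  (Vélu's coordinates up to constants) have poles exactly on `S`, of orders `2`, `3`
  (`ord_trX_of_mem`, `ord_trX_nonneg`: `ord_P(τ_s^* x) = ord_{P+s}(x)`), and values
  `x_S(P) = Σ_s x(P + s)` off `S` (`hasValueAt_trX`).
* **Step B** (`exists_trY_sq_eq`): `y_S² = c₀x_S³ + c₁x_Sy_S + c₂x_S² + c₃y_S + c₄x_S + c₅`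
  with `c₀ ≠ 0` — subtracting leading terms at `O` of the monomials of orders
  `-6, -5, -4, -3, -2` leaves an invariant function regular off `S` with `ord_O ≥ -1`, which is
  constant because `K̄(E)^S` has no function with a single simple orbit of poles
  (`not_simplePoleOrbit`, the substitute for `genus (E/S) = 1`).
* **Step C** (`IsRelation.unique`, `IsRelation.map`, `IsRelation.mem_range_algebraMap`): the
  relation is unique (distinct orders at `O`), its Galois conjugates are again relations (the
  values `x_S(P), y_S(P)` are Galois-equivariant since `S` is `Γ_K`-stable, and a function
  vanishing off `S` is zero, *AEC* II.1.2), so `cᵢ ∈ K̄^{Γ_K} = K` (`K` perfect,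
  Mathlib's `InfiniteGalois.mem_range_algebraMap_iff_fixed`) — Rem. III.4.13.2.
  **`quotCurve`** is the Weierstrass cubic `Y² - c₁XY - c₀c₃Y = X³ + c₂X² + c₀c₄X + c₀²c₅` over
  `K` satisfied by `(X, Y) = (c₀x_S, c₀y_S)` (`equation_quotX_quotY`).
* **Step D** (`quotCurve_Δ_ne_zero`): it is smooth — a singular point `(x₀, y₀)` with tangent
  slopes `α₁, α₂` (tree's `exists_singularPoint`, `eq_singularModel`) would give
  `X - x₀ = (t - α₁)(t - α₂)` for `t = (Y - y₀)/(X - x₀) ∈ K̄(E)^S`, a function with a simple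
  pole at each point of `S` and no other pole, again excluded by `not_simplePoleOrbit` (i.e.
  `K̄(E)^S ≠ K̄(t)`; printed route: Hurwitz, *AEC* II.5.9, and Prop. III.3.1(c)).
* **Step E** (`quotFun`, `quotIsogeny`): the map on points is the specialisation of the
  `K̄(E)`-point `(X, Y)` of `E/S` at each place (`FunctionFieldLPoints.specialize`; *AEC*
  II.2.1), `O` exactly on `S` (`quotFun_eq_zero_iff`), constant on `S`-cosets; by the constancy of
  the fibre degree (tree's `fibreDegree_eq_fibreDegree_zero`, *AEC* II.2.6(a)) it is onto,
  unramified and its fibres are the cosets (`quotFibre_eq_and_quotRam_eq_one`). It is a **group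
  homomorphism** (`quotFun_add`; *AEC* III.4.8, here through divisors and the fixed field instead
  of `Pic⁰`): if `φ(P₁ + P₂) ≠ φP₁ + φP₂ = φP₃`, then with `div f = (P₁) + (P₂) - (P₁+P₂) - (O)`
  on `E` and `div f' = (φP₁) + (φP₂) - (φP₁+φP₂) - (O)` on `E/S` (III.3.5 ⇐, tree's
  `exists_ord_eq_of_pairs`) the invariant function `φ^* f' / ∏_s τ_s^* f` would have divisor
  `Σ_s (P₁+P₂+s) - Σ_s (P₃+s)`. It is algebraic (`isAlgebraicOn_quotFun`) and `Γ_K`-equivariant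
  (`quotFun_smul`), with kernel `S` (`ker_quotIsogeny`); and **`deg φ = #S`**
  (`deg_quotIsogeny`): `#S = #ker φ ∣ deg φ` (tree's III.4.10(b)) while `φ^* K̄(E/S) = K̄(X, Y)`
  contains `K̄(E)^S` (`mem_adjoin_of_invariant`: an invariant function, multiplied by a suitable
  polynomial in `X` to clear its poles off `S`, is a polynomial in `X, Y` by descending induction
  on the pole order at `O`), whose index is `#S` (Artin).

## References

* [SilvermanAEC2009] J. H. Silverman, *The Arithmetic of Elliptic Curves*, 2nd ed., GTM 106,
  Springer 2009: Prop. III.4.12 and its proof, Rem. III.4.13.2, Thm. III.4.10, Thm. III.4.8,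
  Cor. III.4.9, Thm. II.2.3, Prop. II.2.6, II.1.2, II.2.1, Prop. III.3.1, Cor. III.3.5, III.3.6,
  Thm. III.6.1(a).
* J. Vélu, *Isogénies entre courbes elliptiques*, C. R. Acad. Sci. Paris Sér. A 273 (1971),
  238–241 (the coordinates `x_S, y_S`).

## Design

`noncomputable section`, `open scoped Classical`, `K : Type u`, dot-notation extensions in
`namespace WeierstrassCurve` over `K̄ = AlgebraicClosure K` as the sibling files. Real
definitions: `trX`, `trY` (trace coordinates), `quotMono`, `quotMonoOrd`, `quotMonoVal`,
`IsRelation` (the Weierstrass relation and its bookkeeping), `galAut` (an element of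
`Field.absoluteGaloisGroup K` as the algebra automorphism it is), `relCoeff`, `relCoeffK` (the
coefficients, chosen then descended), **`quotCurve`** (`E/S` over `K`), `quotX`, `quotY`,
`quotLPoint` (the generic image), **`quotFun`**, `quotRam`, `quotPullback`, **`quotIsogeny`**;
the instance `instIsEllipticQuotCurve`. The finiteness of `S` is carried as
`hS : (S : Set _).Finite` and the stability as `hstab`, exactly the hypotheses of the named fact.
-/

noncomputable section

open scoped Classical WithZero
open scoped Polynomial.Bivariate
open Polynomial IsDedekindDomain

universe u


/-! # The quotient `E → E/S` (Silverman, *AEC*, Prop. III.4.12) — construction -/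

namespace WeierstrassCurve

open geomPoints Literature.NumberTheory.EllipticCurves.WeierstrassFunctionField

variable {K : Type u} [Field K] {W : WeierstrassCurve K}

/-! ## Step A: the trace coordinates `x_S = Σ_s τ_s^* x`, `y_S = Σ_s τ_s^* y` -/

section Coordinates

/-- Sums over a finite subgroup are invariant under translation of the index. [folklore] -/
theorem sum_toFinset_add_left {M : Type*} [AddCommMonoid M] {S : AddSubgroup W.geomPoints}
    (hS : (S : Set W.geomPoints).Finite) {u : W.geomPoints} (hu : u ∈ S) (f : W.geomPoints → M) :
    ∑ s ∈ hS.toFinset, f (u + s) = ∑ s ∈ hS.toFinset, f s := by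
  refine Finset.sum_nbij' (fun s ↦ u + s) (fun s ↦ s - u) ?_ ?_ ?_ ?_ ?_
  · intro s hs
    rw [Set.Finite.mem_toFinset, SetLike.mem_coe] at hs ⊢
    exact S.add_mem hu hs
  · intro s hs
    rw [Set.Finite.mem_toFinset, SetLike.mem_coe] at hs ⊢
    exact S.sub_mem hs hu
  · intro s _; simp
  · intro s _; simp
  · intro s _; rfl

/-- `x ∈ K̄(E)` as the regular function `x - 0`. [folklore] -/
theorem genX_eq_algebraMap_xSubC : W.genX = algebraMap _ W.geomFunctionField
    (xSubC (W.baseChange (AlgebraicClosure K)).toAffine 0) := by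
  rw [genX, xF, xSubC, map_zero, sub_zero,
    IsScalarTower.algebraMap_apply (AlgebraicClosure K)[X]
      (W.baseChange (AlgebraicClosure K)).toAffine.CoordinateRing W.geomFunctionField]

/-- Finite sums of functions with values have the sum of the values. [folklore] -/
theorem HasValueAt.sum {ι : Type*} (s : Finset ι) {z : ι → W.geomFunctionField} {P : W.geomPoints}
    {c : ι → AlgebraicClosure K} (h : ∀ i ∈ s, W.HasValueAt (z i) P (c i)) :
    W.HasValueAt (∑ i ∈ s, z i) P (∑ i ∈ s, c i) := by
  induction s using Finset.induction_on with
  | empty => simpa using hasValueAt_zero (W := W) P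
  | insert i s hi ih =>
    rw [Finset.sum_insert hi, Finset.sum_insert hi]
    exact (h i (Finset.mem_insert_self i s)).add (ih fun j hj ↦ h j (Finset.mem_insert_of_mem hj))

variable [W.IsElliptic]

/-- `ord_P(x) ≥ 0` at affine `P`. [folklore] -/
theorem ord_genX_nonneg {P : W.geomPoints} (hP : P ≠ 0) :
    0 ≤ ord (W.baseChange (AlgebraicClosure K)).toAffine P W.genX := by
  obtain ⟨a, b, hab, rfl⟩ := geomPoints.exists_eq_some hP
  rw [genX_eq_algebraMap_xSubC]
  exact ord_some_algebraMap_nonneg hab _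

/-- `ord_O(x) = -2`. [cite: SilvermanAEC2009, Prop. III.3.1 (proof of (a))] -/
theorem ord_genX_zero :
    ord (W.baseChange (AlgebraicClosure K)).toAffine (0 : W.geomPoints) W.genX = -2 := by
  rw [genX_eq_algebraMap_xSubC]; exact ord_zero_xSubC 0

/-- `ord_P(y) ≥ 0` at affine `P`. [folklore] -/
theorem ord_genY_nonneg {P : W.geomPoints} (hP : P ≠ 0) :
    0 ≤ ord (W.baseChange (AlgebraicClosure K)).toAffine P W.genY := by
  obtain ⟨a, b, hab, rfl⟩ := geomPoints.exists_eq_some hP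
  exact ord_some_algebraMap_nonneg hab _

/-- `ord_O(y) = -3`. [cite: SilvermanAEC2009, Prop. III.3.1 (proof of (a))] -/
theorem ord_genY_zero :
    ord (W.baseChange (AlgebraicClosure K)).toAffine (0 : W.geomPoints) W.genY = -3 := by
  change ord _ _ (algebraMap _ W.geomFunctionField
    (Affine.CoordinateRing.mk (W.baseChange (AlgebraicClosure K)).toAffine Y)) = -3
  have hne : Affine.CoordinateRing.mk (W.baseChange (AlgebraicClosure K)).toAffine Y ≠ 0 := by
    intro h0
    have : (0 : (AlgebraicClosure K)[X]) • (1 : (W.baseChange (AlgebraicClosure K)).toAffine.CoordinateRing) +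
        (1 : (AlgebraicClosure K)[X]) • Affine.CoordinateRing.mk (W.baseChange (AlgebraicClosure K)).toAffine Y = 0 := by
      rw [zero_smul, one_smul, zero_add]; exact h0
    exact one_ne_zero (Affine.CoordinateRing.smul_basis_eq_zero this).2
  have := ord_zero_algebraMap (V := (W.baseChange (AlgebraicClosure K)).toAffine) hne
  refine this.trans ?_
  have h2 : Affine.CoordinateRing.mk (W.baseChange (AlgebraicClosure K)).toAffine Y =
      (0 : (AlgebraicClosure K)[X]) • (1 : (W.baseChange (AlgebraicClosure K)).toAffine.CoordinateRing) +
        (1 : (AlgebraicClosure K)[X]) • Affine.CoordinateRing.mk (W.baseChange (AlgebraicClosure K)).toAffine Y := by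
    rw [zero_smul, one_smul, zero_add]
  rw [h2, normDeg_smul_basis_eq _ _ (Or.inr one_ne_zero), if_neg one_ne_zero, if_pos rfl]
  simp

variable (W) in
/-- **The trace coordinate `x_S = Σ_{s ∈ S} τ_s^* x ∈ K̄(E)`** of a finite subgroup `S ⊆ E(K̄)`
(Vélu's `X(P) = x(P) + Σ_{s ≠ O} (x(P + s) - x(s))` up to an additive constant). Vélu, C. R.
Acad. Sci. Paris 273 (1971); Silverman, *AEC*, proof of Prop. III.4.12 (functions on `E`
invariant under `τ_s^*`, `s ∈ Φ`). [folklore] -/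
def trX (S : AddSubgroup W.geomPoints) (hS : (S : Set W.geomPoints).Finite) : W.geomFunctionField :=
  ∑ s ∈ hS.toFinset, W.transAlgHom s W.genX

variable (W) in
/-- **The trace coordinate `y_S = Σ_{s ∈ S} τ_s^* y ∈ K̄(E)`.** [folklore] -/
def trY (S : AddSubgroup W.geomPoints) (hS : (S : Set W.geomPoints).Finite) : W.geomFunctionField :=
  ∑ s ∈ hS.toFinset, W.transAlgHom s W.genY

variable {S : AddSubgroup W.geomPoints} (hS : (S : Set W.geomPoints).Finite)

omit [W.IsElliptic] in
/-- Membership in the finite set of points of `S`. [folklore] -/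
theorem mem_finiteToFinset_iff {s : W.geomPoints} : s ∈ hS.toFinset ↔ s ∈ S := by
  rw [Set.Finite.mem_toFinset, SetLike.mem_coe]

/-- `x_S` is `S`-invariant: `τ_u^* x_S = x_S` for `u ∈ S`. [folklore] -/
theorem transAlgHom_trX {u : W.geomPoints} (hu : u ∈ S) : W.transAlgHom u (W.trX S hS) = W.trX S hS := by
  rw [trX, map_sum]
  simp_rw [← AlgHom.comp_apply, ← transAlgHom_add]
  exact sum_toFinset_add_left hS hu fun s ↦ W.transAlgHom s W.genX

/-- `y_S` is `S`-invariant. [folklore] -/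
theorem transAlgHom_trY {u : W.geomPoints} (hu : u ∈ S) : W.transAlgHom u (W.trY S hS) = W.trY S hS := by
  rw [trY, map_sum]
  simp_rw [← AlgHom.comp_apply, ← transAlgHom_add]
  exact sum_toFinset_add_left hS hu fun s ↦ W.transAlgHom s W.genY

/-- Orders of the summands of `x_S`: `ord_P(τ_s^* x) = -2` if `P = -s`, `≥ 0` otherwise. [folklore] -/
theorem ord_transAlgHom_genX (s P : W.geomPoints) :
    (P + s = 0 → ord (W.baseChange (AlgebraicClosure K)).toAffine P (W.transAlgHom s W.genX) = -2) ∧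
    (P + s ≠ 0 → 0 ≤ ord (W.baseChange (AlgebraicClosure K)).toAffine P (W.transAlgHom s W.genX)) := by
  rw [ord_transAlgHom]
  exact ⟨fun h ↦ by rw [h]; exact ord_genX_zero, fun h ↦ ord_genX_nonneg h⟩

/-- Orders of the summands of `y_S`. [folklore] -/
theorem ord_transAlgHom_genY (s P : W.geomPoints) :
    (P + s = 0 → ord (W.baseChange (AlgebraicClosure K)).toAffine P (W.transAlgHom s W.genY) = -3) ∧
    (P + s ≠ 0 → 0 ≤ ord (W.baseChange (AlgebraicClosure K)).toAffine P (W.transAlgHom s W.genY)) := by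
  rw [ord_transAlgHom]
  exact ⟨fun h ↦ by rw [h]; exact ord_genY_zero, fun h ↦ ord_genY_nonneg h⟩

/-- **`x_S ≠ 0` and `ord_P(x_S) = -2` at the points of `S`** (one summand has a double pole,
the others are regular). [folklore] -/
theorem trX_ne_zero_and_ord_eq {P : W.geomPoints} (hP : P ∈ S) :
    W.trX S hS ≠ 0 ∧ ord (W.baseChange (AlgebraicClosure K)).toAffine P (W.trX S hS) = -2 := by
  have hmem : -P ∈ hS.toFinset := (mem_finiteToFinset_iff hS).mpr (S.neg_mem hP)
  have hne : W.transAlgHom (-P) W.genX ≠ 0 :=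
    (map_ne_zero_iff _ (W.transAlgHom _).injective).mpr fun h ↦ transcendental_genX W (h ▸ isAlgebraic_zero)
  have key := ord_sum_eq_of_lt (V := (W.baseChange (AlgebraicClosure K)).toAffine) P hS.toFinset
    (fun s ↦ W.transAlgHom s W.genX) hmem hne (by
      intro s _ hs
      right
      rw [(ord_transAlgHom_genX (-P) P).1 (add_neg_cancel P)]
      have := (ord_transAlgHom_genX s P).2 (fun h ↦ hs (eq_neg_of_add_eq_zero_right h))
      omega)
  rw [(ord_transAlgHom_genX (-P) P).1 (add_neg_cancel P)] at key
  exact key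

/-- **`y_S ≠ 0` and `ord_P(y_S) = -3` at the points of `S`.** [folklore] -/
theorem trY_ne_zero_and_ord_eq {P : W.geomPoints} (hP : P ∈ S) :
    W.trY S hS ≠ 0 ∧ ord (W.baseChange (AlgebraicClosure K)).toAffine P (W.trY S hS) = -3 := by
  have hmem : -P ∈ hS.toFinset := (mem_finiteToFinset_iff hS).mpr (S.neg_mem hP)
  have hne : W.transAlgHom (-P) W.genY ≠ 0 := by
    refine (map_ne_zero_iff _ (W.transAlgHom _).injective).mpr fun h ↦ ?_
    have := ord_genY_zero (W := W)
    rw [h] at this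
    simp [ord] at this
  have key := ord_sum_eq_of_lt (V := (W.baseChange (AlgebraicClosure K)).toAffine) P hS.toFinset
    (fun s ↦ W.transAlgHom s W.genY) hmem hne (by
      intro s _ hs
      right
      rw [(ord_transAlgHom_genY (-P) P).1 (add_neg_cancel P)]
      have := (ord_transAlgHom_genY s P).2 (fun h ↦ hs (eq_neg_of_add_eq_zero_right h))
      omega)
  rw [(ord_transAlgHom_genY (-P) P).1 (add_neg_cancel P)] at key
  exact key

/-- `x_S ≠ 0`. [folklore] -/
theorem trX_ne_zero : W.trX S hS ≠ 0 := (trX_ne_zero_and_ord_eq hS S.zero_mem).1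

/-- `y_S ≠ 0`. [folklore] -/
theorem trY_ne_zero : W.trY S hS ≠ 0 := (trY_ne_zero_and_ord_eq hS S.zero_mem).1

/-- `ord_P(x_S) = -2` on `S`. [folklore] -/
theorem ord_trX_of_mem {P : W.geomPoints} (hP : P ∈ S) :
    ord (W.baseChange (AlgebraicClosure K)).toAffine P (W.trX S hS) = -2 :=
  (trX_ne_zero_and_ord_eq hS hP).2

/-- `ord_P(y_S) = -3` on `S`. [folklore] -/
theorem ord_trY_of_mem {P : W.geomPoints} (hP : P ∈ S) :
    ord (W.baseChange (AlgebraicClosure K)).toAffine P (W.trY S hS) = -3 :=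
  (trY_ne_zero_and_ord_eq hS hP).2

/-- **`x_S` is regular off `S`.** [folklore] -/
theorem ord_trX_nonneg {P : W.geomPoints} (hP : P ∉ S) :
    0 ≤ ord (W.baseChange (AlgebraicClosure K)).toAffine P (W.trX S hS) := by
  refine le_ord_sum (V := (W.baseChange (AlgebraicClosure K)).toAffine) P hS.toFinset _ 0
    (fun s hs _ ↦ (ord_transAlgHom_genX s P).2 fun h ↦ hP ?_) (trX_ne_zero hS)
  rw [eq_neg_of_add_eq_zero_left h]
  exact S.neg_mem ((mem_finiteToFinset_iff hS).mp hs)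

/-- **`y_S` is regular off `S`.** [folklore] -/
theorem ord_trY_nonneg {P : W.geomPoints} (hP : P ∉ S) :
    0 ≤ ord (W.baseChange (AlgebraicClosure K)).toAffine P (W.trY S hS) := by
  refine le_ord_sum (V := (W.baseChange (AlgebraicClosure K)).toAffine) P hS.toFinset _ 0
    (fun s hs _ ↦ (ord_transAlgHom_genY s P).2 fun h ↦ hP ?_) (trY_ne_zero hS)
  rw [eq_neg_of_add_eq_zero_left h]
  exact S.neg_mem ((mem_finiteToFinset_iff hS).mp hs)

/-- `v_P(x_S) ≤ 1` off `S`. [folklore] -/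
theorem placeValuation_trX_le_one {P : W.geomPoints} (hP : P ∉ S) :
    placeValuation (W.baseChange (AlgebraicClosure K)).toAffine P (W.trX S hS) ≤ 1 :=
  (placeValuation_le_one_iff_ord_nonneg P (trX_ne_zero hS)).mpr (ord_trX_nonneg hS hP)

/-- `v_P(y_S) ≤ 1` off `S`. [folklore] -/
theorem placeValuation_trY_le_one {P : W.geomPoints} (hP : P ∉ S) :
    placeValuation (W.baseChange (AlgebraicClosure K)).toAffine P (W.trY S hS) ≤ 1 :=
  (placeValuation_le_one_iff_ord_nonneg P (trY_ne_zero hS)).mpr (ord_trY_nonneg hS hP)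

/-- `1 < v_P(x_S)` (a pole) iff `P ∈ S`. [folklore] -/
theorem one_lt_placeValuation_trX_iff (P : W.geomPoints) :
    1 < placeValuation (W.baseChange (AlgebraicClosure K)).toAffine P (W.trX S hS) ↔ P ∈ S := by
  rw [one_lt_placeValuation_iff_ord_neg P (trX_ne_zero hS)]
  constructor
  · intro h; by_contra hP; have := ord_trX_nonneg hS hP; omega
  · intro h; rw [ord_trX_of_mem hS h]; norm_num

/-- **The values of `x_S` off `S`: `x_S(P) = Σ_{s ∈ S} x(P + s)`.** [folklore] -/
theorem hasValueAt_trX {P : W.geomPoints} (hP : P ∉ S) :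
    W.HasValueAt (W.trX S hS) P (∑ s ∈ hS.toFinset, xy (P + s) 0) := by
  have hP0 : P ≠ 0 := fun h ↦ hP (h ▸ S.zero_mem)
  refine HasValueAt.sum _ fun s hs ↦ ?_
  have hs' : s ∈ S := (mem_finiteToFinset_iff hS).mp hs
  have hPs : P ≠ s := fun h ↦ hP (h ▸ hs')
  have hPs' : P + s ≠ 0 := fun h ↦ hP (by rw [eq_neg_of_add_eq_zero_left h]; exact S.neg_mem hs')
  simpa using hasValueAt_transAlgHom_gen hP0 hPs hPs' 0

/-- **The values of `y_S` off `S`: `y_S(P) = Σ_{s ∈ S} y(P + s)`.** [folklore] -/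
theorem hasValueAt_trY {P : W.geomPoints} (hP : P ∉ S) :
    W.HasValueAt (W.trY S hS) P (∑ s ∈ hS.toFinset, xy (P + s) 1) := by
  have hP0 : P ≠ 0 := fun h ↦ hP (h ▸ S.zero_mem)
  refine HasValueAt.sum _ fun s hs ↦ ?_
  have hs' : s ∈ S := (mem_finiteToFinset_iff hS).mp hs
  have hPs : P ≠ s := fun h ↦ hP (h ▸ hs')
  have hPs' : P + s ≠ 0 := fun h ↦ hP (by rw [eq_neg_of_add_eq_zero_left h]; exact S.neg_mem hs')
  simpa using hasValueAt_transAlgHom_gen hP0 hPs hPs' 1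

end Coordinates

end WeierstrassCurve


namespace WeierstrassCurve

open geomPoints Literature.NumberTheory.EllipticCurves.WeierstrassFunctionField

variable {K : Type u} [Field K] {W : WeierstrassCurve K} [W.IsElliptic]

/-! ## Step B: the Weierstrass relation between `x_S` and `y_S` -/

section Relation

/-- An `S`-invariant function which is regular off `S` and has `ord_O ≥ -1` is a constant:
`ord_O = -1` would make its polar divisor the simple orbit `S` (`not_simplePoleOrbit`), and
`ord_O ≥ 0` propagates to `S` by invariance. [folklore] -/
theorem exists_eq_algebraMap_of_invariant {S : AddSubgroup W.geomPoints}
    (hS : (S : Set W.geomPoints).Finite) {h : W.geomFunctionField}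
    (hinv : ∀ s ∈ S, W.transAlgHom s h = h)
    (hreg : ∀ P : W.geomPoints, P ∉ S → 0 ≤ ord (W.baseChange (AlgebraicClosure K)).toAffine P h)
    (hO : h = 0 ∨ -1 ≤ ord (W.baseChange (AlgebraicClosure K)).toAffine (0 : W.geomPoints) h) :
    ∃ c : AlgebraicClosure K, algebraMap (AlgebraicClosure K) W.geomFunctionField c = h := by
  rcases eq_or_ne h 0 with rfl | hh
  · exact ⟨0, map_zero _⟩
  have hO' : -1 ≤ ord (W.baseChange (AlgebraicClosure K)).toAffine (0 : W.geomPoints) h :=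
    hO.resolve_left hh
  have hS' : ∀ s ∈ S, ord (W.baseChange (AlgebraicClosure K)).toAffine ((0 : W.geomPoints) + s) h =
      ord (W.baseChange (AlgebraicClosure K)).toAffine (0 : W.geomPoints) h := fun s hs ↦
    ord_add_eq_of_transAlgHom_eq (hinv s hs) 0
  rcases hO'.lt_or_eq with hlt | heq
  · -- no poles at all
    refine exists_eq_algebraMap_of_ord_nonneg fun P ↦ ?_
    by_cases hP : P ∈ S
    · have := hS' P hP
      rw [zero_add] at this
      rw [this]; omega
    · exact hreg P hP
  · exfalso
    exact not_simplePoleOrbit hS hh hinv 0 (fun s hs ↦ by rw [hS' s hs, ← heq])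
      (fun P hP ↦ hreg P (by rwa [sub_zero] at hP))

/-- One reduction step at `O`: subtract a constant multiple of a "monomial" `m` of order
`ord_O(m) = -n` from `R` with `R = 0 ∨ ord_O(R) ≥ -n`, leaving `R' = 0 ∨ ord_O(R') ≥ -n + 1`
(`exists_ord_sub_smul_gt_of_le`). [folklore] -/
theorem exists_sub_smul_ord_ge {R m : W.geomFunctionField} (hm : m ≠ 0) {n : ℤ}
    (hmo : ord (W.baseChange (AlgebraicClosure K)).toAffine (0 : W.geomPoints) m = n)
    (hR : R = 0 ∨ n ≤ ord (W.baseChange (AlgebraicClosure K)).toAffine (0 : W.geomPoints) R) :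
    ∃ c : AlgebraicClosure K,
      R - algebraMap (AlgebraicClosure K) W.geomFunctionField c * m = 0 ∨
        n + 1 ≤ ord (W.baseChange (AlgebraicClosure K)).toAffine (0 : W.geomPoints)
          (R - algebraMap (AlgebraicClosure K) W.geomFunctionField c * m) := by
  obtain ⟨c, hc⟩ := exists_ord_sub_smul_gt_of_le (V := (W.baseChange (AlgebraicClosure K)).toAffine)
    (0 : W.geomPoints) (u := R) hm (by rw [hmo]; exact hR)
  refine ⟨c, hc.imp id fun h ↦ ?_⟩
  change _ < ord _ _ (R - algebraMap (AlgebraicClosure K) W.geomFunctionField c * m) at h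
  rw [hmo] at h
  omega

/-- **The Weierstrass relation**: `y_S² = c₆ x_S³ + c₅ x_S y_S + c₄ x_S² + c₃ y_S + c₂ x_S + c₀`
in `K̄(E)` with `c₆ ≠ 0`. The seven functions `y_S², x_S³, x_S y_S, x_S², y_S, x_S, 1` are
`S`-invariant, regular off `S`, of orders `-6, -6, -5, -4, -3, -2, 0` at `O`; subtracting
leading terms at `O` (`exists_sub_smul_ord_ge`) leaves an invariant function regular off `S` with
`ord_O ≥ -1`, which is constant (`exists_eq_algebraMap_of_invariant`). Silverman, *AEC*,
proof of Prop. III.3.1(a) (the same argument for `E` itself, `S = {O}`, through Riemann–Roch),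
Prop. III.4.12. [folklore] -/
theorem exists_trY_sq_eq {S : AddSubgroup W.geomPoints} (hS : (S : Set W.geomPoints).Finite) :
    ∃ c₆ c₅ c₄ c₃ c₂ c₀ : AlgebraicClosure K, c₆ ≠ 0 ∧
      W.trY S hS ^ 2 = algebraMap _ W.geomFunctionField c₆ * W.trX S hS ^ 3 +
        algebraMap _ W.geomFunctionField c₅ * (W.trX S hS * W.trY S hS) +
        algebraMap _ W.geomFunctionField c₄ * W.trX S hS ^ 2 +
        algebraMap _ W.geomFunctionField c₃ * W.trY S hS +
        algebraMap _ W.geomFunctionField c₂ * W.trX S hS +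
        algebraMap _ W.geomFunctionField c₀ := by
  set x := W.trX S hS with hx
  set y := W.trY S hS with hy
  have hx0 : x ≠ 0 := trX_ne_zero hS
  have hy0 : y ≠ 0 := trY_ne_zero hS
  have hox : ord (W.baseChange (AlgebraicClosure K)).toAffine (0 : W.geomPoints) x = -2 :=
    ord_trX_of_mem hS S.zero_mem
  have hoy : ord (W.baseChange (AlgebraicClosure K)).toAffine (0 : W.geomPoints) y = -3 :=
    ord_trY_of_mem hS S.zero_mem
  -- orders of the monomials at `O`
  have ho6 : ord (W.baseChange (AlgebraicClosure K)).toAffine (0 : W.geomPoints) (x ^ 3) = -6 := by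
    rw [ord_pow _ hx0, hox]; norm_num
  have ho6' : ord (W.baseChange (AlgebraicClosure K)).toAffine (0 : W.geomPoints) (y ^ 2) = -6 := by
    rw [ord_pow _ hy0, hoy]; norm_num
  have ho5 : ord (W.baseChange (AlgebraicClosure K)).toAffine (0 : W.geomPoints) (x * y) = -5 := by
    rw [ord_mul _ hx0 hy0, hox, hoy]; norm_num
  have ho4 : ord (W.baseChange (AlgebraicClosure K)).toAffine (0 : W.geomPoints) (x ^ 2) = -4 := by
    rw [ord_pow _ hx0, hox]; norm_num
  -- the reduction chain
  obtain ⟨c₆, hc₆, h6⟩ := exists_ord_sub_smul_gt (V := (W.baseChange (AlgebraicClosure K)).toAffine)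
    (0 : W.geomPoints) (pow_ne_zero 2 hy0) (pow_ne_zero 3 hx0) (ho6'.trans ho6.symm)
  have h6' : y ^ 2 - algebraMap _ W.geomFunctionField c₆ * x ^ 3 = 0 ∨
      (-5 : ℤ) ≤ ord (W.baseChange (AlgebraicClosure K)).toAffine (0 : W.geomPoints)
        (y ^ 2 - algebraMap _ W.geomFunctionField c₆ * x ^ 3) := by
    refine h6.imp id fun h ↦ ?_
    change _ < ord _ _ (y ^ 2 - algebraMap (AlgebraicClosure K) W.geomFunctionField c₆ * x ^ 3) at h
    rw [ho6] at h; omega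
  obtain ⟨c₅, h5⟩ := exists_sub_smul_ord_ge (mul_ne_zero hx0 hy0) ho5 h6'
  obtain ⟨c₄, h4⟩ := exists_sub_smul_ord_ge (pow_ne_zero 2 hx0) ho4 (by norm_num at h5 ⊢; exact h5)
  obtain ⟨c₃, h3⟩ := exists_sub_smul_ord_ge hy0 hoy (by norm_num at h4 ⊢; exact h4)
  obtain ⟨c₂, h2⟩ := exists_sub_smul_ord_ge hx0 hox (by norm_num at h3 ⊢; exact h3)
  norm_num at h2
  set R := y ^ 2 - algebraMap _ W.geomFunctionField c₆ * x ^ 3 -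
    algebraMap _ W.geomFunctionField c₅ * (x * y) - algebraMap _ W.geomFunctionField c₄ * x ^ 2 -
    algebraMap _ W.geomFunctionField c₃ * y - algebraMap _ W.geomFunctionField c₂ * x with hR
  -- `R` is invariant and regular off `S`
  have hinv : ∀ s ∈ S, W.transAlgHom s R = R := fun s hs ↦ by
    simp only [hR, map_sub, map_mul, map_pow, AlgHom.commutes, hx, hy, transAlgHom_trX hS hs,
      transAlgHom_trY hS hs]
  have hreg : ∀ P : W.geomPoints, P ∉ S → 0 ≤ ord (W.baseChange (AlgebraicClosure K)).toAffine P R := by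
    intro P hP
    rcases eq_or_ne R 0 with h0 | hR0
    · rw [h0]; simp [ord]
    refine (placeValuation_le_one_iff_ord_nonneg P hR0).mp ?_
    have hvx : x ∈ (placeValuation (W.baseChange (AlgebraicClosure K)).toAffine P).integer :=
      placeValuation_trX_le_one hS hP
    have hvy : y ∈ (placeValuation (W.baseChange (AlgebraicClosure K)).toAffine P).integer :=
      placeValuation_trY_le_one hS hP
    have hc : ∀ c : AlgebraicClosure K, algebraMap _ W.geomFunctionField c ∈
        (placeValuation (W.baseChange (AlgebraicClosure K)).toAffine P).integer := fun c ↦ by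
      change placeValuation _ P _ ≤ 1
      by_cases hc : c = 0
      · simp [hc]
      · exact (placeValuation_algebraMap P hc).le
    change R ∈ (placeValuation (W.baseChange (AlgebraicClosure K)).toAffine P).integer
    rw [hR]
    exact Subring.sub_mem _ (Subring.sub_mem _ (Subring.sub_mem _ (Subring.sub_mem _ (Subring.sub_mem _
      (Subring.pow_mem _ hvy 2) (Subring.mul_mem _ (hc _) (Subring.pow_mem _ hvx 3)))
      (Subring.mul_mem _ (hc _) (Subring.mul_mem _ hvx hvy))) (Subring.mul_mem _ (hc _) (Subring.pow_mem _ hvx 2)))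
      (Subring.mul_mem _ (hc _) hvy)) (Subring.mul_mem _ (hc _) hvx)
  obtain ⟨c₀, hc₀⟩ := exists_eq_algebraMap_of_invariant hS hinv hreg h2
  refine ⟨c₆, c₅, c₄, c₃, c₂, c₀, hc₆, ?_⟩
  rw [hR] at hc₀
  linear_combination -hc₀

end Relation

end WeierstrassCurve


namespace WeierstrassCurve

open geomPoints Literature.NumberTheory.EllipticCurves.WeierstrassFunctionField

variable {K : Type u} [Field K] {W : WeierstrassCurve K} [W.IsElliptic]
variable {S : AddSubgroup W.geomPoints} (hS : (S : Set W.geomPoints).Finite)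

/-! ## Step C: the relation is unique, hence defined over `K` -/

section Descent

variable (W) in
/-- The six monomials `x_S³, x_S y_S, x_S², y_S, x_S, 1` of the Weierstrass relation. [folklore] -/
def quotMono (S : AddSubgroup W.geomPoints) (hS : (S : Set W.geomPoints).Finite) :
    Fin 6 → W.geomFunctionField :=
  ![W.trX S hS ^ 3, W.trX S hS * W.trY S hS, W.trX S hS ^ 2, W.trY S hS, W.trX S hS, 1]

/-- The orders at `O` of the six monomials: `-6, -5, -4, -3, -2, 0`. [folklore] -/
def quotMonoOrd : Fin 6 → ℤ := ![-6, -5, -4, -3, -2, 0]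

variable (W) in
/-- **The Weierstrass relation with coefficients `c`**: `y_S² = Σ_i c_i · mono_i`, i.e.
`y_S² = c₀ x_S³ + c₁ x_S y_S + c₂ x_S² + c₃ y_S + c₄ x_S + c₅`. [folklore] -/
def IsRelation (S : AddSubgroup W.geomPoints) (hS : (S : Set W.geomPoints).Finite)
    (c : Fin 6 → AlgebraicClosure K) : Prop :=
  W.trY S hS ^ 2 = ∑ i, c i • W.quotMono S hS i

/-- **Existence of the relation** (`exists_trY_sq_eq` repackaged), with `c₀ ≠ 0`. [folklore] -/
theorem exists_isRelation : ∃ c : Fin 6 → AlgebraicClosure K, c 0 ≠ 0 ∧ W.IsRelation S hS c := by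
  obtain ⟨c₆, c₅, c₄, c₃, c₂, c₀, hc₆, h⟩ := exists_trY_sq_eq hS
  refine ⟨![c₆, c₅, c₄, c₃, c₂, c₀], hc₆, ?_⟩
  rw [IsRelation, Fin.sum_univ_six]
  simp only [quotMono, Matrix.cons_val_zero, Matrix.cons_val_one, Matrix.cons_val, Algebra.smul_def,
    mul_one]
  exact h

/-- The monomials are non-zero with the stated orders at `O`. [folklore] -/
theorem quotMono_ne_zero_and_ord (i : Fin 6) : W.quotMono S hS i ≠ 0 ∧
    ord (W.baseChange (AlgebraicClosure K)).toAffine (0 : W.geomPoints) (W.quotMono S hS i) = quotMonoOrd i := by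
  have hx0 := trX_ne_zero hS
  have hy0 := trY_ne_zero hS
  have hox := ord_trX_of_mem hS S.zero_mem
  have hoy := ord_trY_of_mem hS S.zero_mem
  fin_cases i
  · change W.trX S hS ^ 3 ≠ 0 ∧ ord _ (0 : W.geomPoints) (W.trX S hS ^ 3) = -6
    exact ⟨pow_ne_zero 3 hx0, by rw [ord_pow _ hx0, hox]; norm_num⟩
  · change W.trX S hS * W.trY S hS ≠ 0 ∧ ord _ (0 : W.geomPoints) (W.trX S hS * W.trY S hS) = -5
    exact ⟨mul_ne_zero hx0 hy0, by rw [ord_mul _ hx0 hy0, hox, hoy]; norm_num⟩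
  · change W.trX S hS ^ 2 ≠ 0 ∧ ord _ (0 : W.geomPoints) (W.trX S hS ^ 2) = -4
    exact ⟨pow_ne_zero 2 hx0, by rw [ord_pow _ hx0, hox]; norm_num⟩
  · exact ⟨hy0, hoy⟩
  · exact ⟨hx0, hox⟩
  · change (1 : W.geomFunctionField) ≠ 0 ∧ ord _ (0 : W.geomPoints) (1 : W.geomFunctionField) = 0
    exact ⟨one_ne_zero, by simp [ord]⟩

/-- **Uniqueness of the relation**: the monomials have distinct orders at `O`, hence are linearly
independent over `K̄`. [folklore] -/
theorem IsRelation.unique {c c' : Fin 6 → AlgebraicClosure K} (h : W.IsRelation S hS c)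
    (h' : W.IsRelation S hS c') : c = c' := by
  have hsum : ∑ i ∈ Finset.univ, (c i - c' i) • W.quotMono S hS i = 0 := by
    simp_rw [sub_smul]
    rw [Finset.sum_sub_distrib]
    rw [IsRelation] at h h'
    rw [← h, ← h', sub_self]
  have key := eq_zero_of_sum_smul_eq_zero_of_ord_injective
    (V := (W.baseChange (AlgebraicClosure K)).toAffine) (0 : W.geomPoints) Finset.univ (W.quotMono S hS)
    (fun i ↦ c i - c' i) (fun i _ ↦ (quotMono_ne_zero_and_ord hS i).1) (by
      intro i _ i' _ hii'
      rw [(quotMono_ne_zero_and_ord hS i).2, (quotMono_ne_zero_and_ord hS i').2] at hii'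
      fin_cases i <;> fin_cases i' <;> simp_all [quotMonoOrd]) hsum
  funext i
  exact sub_eq_zero.mp (key i (Finset.mem_univ i))

/-- The values of the monomials off `S`. [folklore] -/
def quotMonoVal (a b : AlgebraicClosure K) : Fin 6 → AlgebraicClosure K := ![a ^ 3, a * b, a ^ 2, b, a, 1]

/-- The monomials have the values `quotMonoVal` at a point where `x_S, y_S` have values `a, b`.
[folklore] -/
theorem hasValueAt_quotMono {P : W.geomPoints} {a b : AlgebraicClosure K}
    (ha : W.HasValueAt (W.trX S hS) P a) (hb : W.HasValueAt (W.trY S hS) P b) (i : Fin 6) :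
    W.HasValueAt (W.quotMono S hS i) P (quotMonoVal a b i) := by
  fin_cases i
  · exact ha.pow 3
  · exact ha.mul hb
  · exact ha.pow 2
  · exact hb
  · exact ha
  · exact hasValueAt_one P

/-- **The relation on values**: if `y_S² = Σ c_i mono_i` and `x_S, y_S` have values `a, b` at an
affine `P`, then `b² = Σ c_i monoVal_i(a, b)`. [folklore] -/
theorem IsRelation.eval {c : Fin 6 → AlgebraicClosure K} (h : W.IsRelation S hS c)
    {P : W.geomPoints} (hP : P ≠ 0) {a b : AlgebraicClosure K}
    (ha : W.HasValueAt (W.trX S hS) P a) (hb : W.HasValueAt (W.trY S hS) P b) :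
    b ^ 2 = ∑ i, c i * quotMonoVal a b i := by
  have h1 : W.HasValueAt (W.trY S hS ^ 2) P (b ^ 2) := hb.pow 2
  have h2 : W.HasValueAt (∑ i, c i • W.quotMono S hS i) P (∑ i, c i * quotMonoVal a b i) := by
    refine HasValueAt.sum _ fun i _ ↦ ?_
    rw [Algebra.smul_def]
    exact (hasValueAt_algebraMap (c i) P).mul (hasValueAt_quotMono hS ha hb i)
  rw [IsRelation] at h
  rw [h] at h1
  exact h1.unique hP h2

variable (K) in
omit [W.IsElliptic] in
/-- An element of `Γ_K = Gal(K̄/K)` (Mathlib's `Field.absoluteGaloisGroup K`, a type synonym) as the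
`K`-algebra automorphism of `K̄` it is. [folklore] -/
abbrev galAut (σ : Field.absoluteGaloisGroup K) : AlgebraicClosure K ≃ₐ[K] AlgebraicClosure K := σ

omit [W.IsElliptic] in
/-- Galois automorphisms act on coordinates: `σ (x(R)) = x(σ • R)`, `σ (y(R)) = y(σ • R)`.
[folklore] -/
theorem geomPoints.xy_smul (σ : Field.absoluteGaloisGroup K) (R : W.geomPoints)
    (i : Fin 2) : galAut K σ (xy R i) = xy (σ • R) i := by
  cases R with
  | zero =>
    change galAut K σ (xy (0 : W.geomPoints) i) = xy (σ • (0 : W.geomPoints)) i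
    rw [smul_zero, xy_zero]; simp
  | some a b h =>
    change galAut K σ (xy (Affine.Point.some a b h : W.geomPoints) i) =
      xy (Affine.Point.map (galAut K σ : AlgebraicClosure K →ₐ[K] AlgebraicClosure K)
        (Affine.Point.some a b h)) i
    rw [Affine.Point.map_some, xy_some, xy_some]
    fin_cases i <;> rfl

omit [W.IsElliptic] in
/-- Reindexing a sum over `S` by a Galois automorphism stabilising `S`. [folklore] -/
theorem sum_toFinset_smul {M : Type*} [AddCommMonoid M] (σ : Field.absoluteGaloisGroup K)
    (hstab : ∀ (τ : Field.absoluteGaloisGroup K) (s : W.geomPoints), s ∈ S → τ • s ∈ S)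
    (f : W.geomPoints → M) : ∑ s ∈ hS.toFinset, f (σ • s) = ∑ s ∈ hS.toFinset, f s := by
  refine Finset.sum_nbij' (fun s ↦ σ • s) (fun s ↦ σ⁻¹ • s) ?_ ?_ ?_ ?_ ?_
  · intro s hs
    rw [mem_finiteToFinset_iff] at hs ⊢
    exact hstab σ s hs
  · intro s hs
    rw [mem_finiteToFinset_iff] at hs ⊢
    exact hstab σ⁻¹ s hs
  · intro s _; simp
  · intro s _; simp
  · intro s _; rfl

omit [W.IsElliptic] in
/-- **Galois acts on the values of the trace coordinates**: `σ (x_S(P)) = x_S(σ • P)` (as sums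
`Σ_s x(P + s)`), for `S` Galois-stable. [folklore] -/
theorem smul_sum_xy (σ : Field.absoluteGaloisGroup K)
    (hstab : ∀ (τ : Field.absoluteGaloisGroup K) (s : W.geomPoints), s ∈ S → τ • s ∈ S)
    (P : W.geomPoints) (i : Fin 2) :
    galAut K σ (∑ s ∈ hS.toFinset, xy (P + s) i) = ∑ s ∈ hS.toFinset, xy (σ • P + s) i := by
  rw [map_sum]
  simp_rw [geomPoints.xy_smul, smul_add]
  exact sum_toFinset_smul hS σ hstab fun s ↦ xy (σ • P + s) i

/-- **Descent**: if `S` is Galois-stable, the conjugate `σ ∘ c` of a relation is again a relation —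
at every `Q ∉ S` the function `y_S² - Σ σ(c_i) mono_i` vanishes (apply `σ` to the relation on
values at `σ⁻¹ Q`), so it vanishes identically (*AEC* II.1.2). [folklore] -/
theorem IsRelation.map {c : Fin 6 → AlgebraicClosure K} (h : W.IsRelation S hS c)
    (σ : Field.absoluteGaloisGroup K)
    (hstab : ∀ (τ : Field.absoluteGaloisGroup K) (s : W.geomPoints), s ∈ S → τ • s ∈ S) :
    W.IsRelation S hS (fun i ↦ galAut K σ (c i)) := by
  rw [IsRelation, ← sub_eq_zero]
  apply eq_zero_of_infinite_setOf_hasValueAt_zero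
  -- every `Q ∉ S` is a zero
  have hsub : (S : Set W.geomPoints)ᶜ ⊆
      {Q : W.geomPoints | Q ≠ 0 ∧ W.HasValueAt (W.trY S hS ^ 2 - ∑ i, galAut K σ (c i) • W.quotMono S hS i) Q 0} := by
    intro Q hQ
    rw [Set.mem_compl_iff, SetLike.mem_coe] at hQ
    have hQ0 : Q ≠ 0 := fun h0 ↦ hQ (h0 ▸ S.zero_mem)
    set P := σ⁻¹ • Q with hP
    have hPQ : σ • P = Q := by rw [hP, smul_inv_smul]
    have hP' : P ∉ S := fun hPS ↦ hQ (hPQ ▸ hstab σ P hPS)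
    have hP0 : P ≠ 0 := fun h0 ↦ hP' (h0 ▸ S.zero_mem)
    -- values at `P` and at `Q`
    set a := ∑ s ∈ hS.toFinset, xy (P + s) 0
    set b := ∑ s ∈ hS.toFinset, xy (P + s) 1
    have ha : W.HasValueAt (W.trX S hS) P a := hasValueAt_trX hS hP'
    have hb : W.HasValueAt (W.trY S hS) P b := hasValueAt_trY hS hP'
    have hrel := h.eval hS hP0 ha hb
    have haQ : W.HasValueAt (W.trX S hS) Q (galAut K σ a) := by
      rw [smul_sum_xy hS σ hstab P 0, hPQ]; exact hasValueAt_trX hS hQ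
    have hbQ : W.HasValueAt (W.trY S hS) Q (galAut K σ b) := by
      rw [smul_sum_xy hS σ hstab P 1, hPQ]; exact hasValueAt_trY hS hQ
    have hval : W.HasValueAt (W.trY S hS ^ 2 - ∑ i, galAut K σ (c i) • W.quotMono S hS i) Q
        ((galAut K σ b) ^ 2 - ∑ i, galAut K σ (c i) * quotMonoVal (galAut K σ a) (galAut K σ b) i) := by
      refine (hbQ.pow 2).sub (HasValueAt.sum _ fun i _ ↦ ?_)
      rw [Algebra.smul_def]
      exact (hasValueAt_algebraMap _ Q).mul (hasValueAt_quotMono hS haQ hbQ i)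
    have hzero : (galAut K σ b) ^ 2 -
        ∑ i, galAut K σ (c i) * quotMonoVal (galAut K σ a) (galAut K σ b) i = 0 := by
      rw [sub_eq_zero, ← map_pow, hrel, map_sum]
      refine Finset.sum_congr rfl fun i _ ↦ ?_
      rw [map_mul]
      congr 1
      fin_cases i <;> simp [quotMonoVal, map_pow, map_mul]
    refine ⟨hQ0, ?_⟩
    rw [hzero] at hval
    exact hval
  exact ((Set.Finite.infinite_compl hS).mono hsub)

/-- **The coefficients of the relation lie in `K`** (`K` perfect, `S` Galois-stable): they are
fixed by `Gal(K̄/K)` (`IsRelation.map` and uniqueness), and `K̄^{Gal(K̄/K)} = K`. Silverman,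
*AEC*, Rem. III.4.13.2 (the quotient by a `G_{K̄/K}`-invariant subgroup is defined over `K`).
[cite: SilvermanAEC2009, Rem. III.4.13.2] -/
theorem IsRelation.mem_range_algebraMap [PerfectField K] {c : Fin 6 → AlgebraicClosure K}
    (h : W.IsRelation S hS c)
    (hstab : ∀ (τ : Field.absoluteGaloisGroup K) (s : W.geomPoints), s ∈ S → τ • s ∈ S)
    (i : Fin 6) : c i ∈ Set.range (algebraMap K (AlgebraicClosure K)) := by
  haveI : IsGalois K (AlgebraicClosure K) := {}
  refine (InfiniteGalois.mem_range_algebraMap_iff_fixed (c i)).mpr fun f ↦ ?_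
  have := (h.map hS (f : Field.absoluteGaloisGroup K) hstab).unique hS h
  exact congrFun this i

end Descent

end WeierstrassCurve


namespace WeierstrassCurve

open _root_.WeierstrassCurve.geomPoints Literature.NumberTheory.EllipticCurves.WeierstrassFunctionField

variable {K : Type u} [Field K] {W : WeierstrassCurve K} [W.IsElliptic]
variable {S : AddSubgroup W.geomPoints} (hS : (S : Set W.geomPoints).Finite)

/-! ## Step C': the quotient curve `E/S` over `K` -/

section QuotCurve

/-- **The coefficients of the Weierstrass relation** `y_S² = Σ c_i mono_i` (a choice; unique by
`IsRelation.unique`), with `c₀ ≠ 0`. [folklore] -/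
def relCoeff : Fin 6 → AlgebraicClosure K := (exists_isRelation hS).choose

/-- The leading coefficient `c₀ ≠ 0`. [folklore] -/
theorem relCoeff_zero_ne_zero : W.relCoeff hS 0 ≠ 0 := (exists_isRelation hS).choose_spec.1

/-- The chosen coefficients satisfy the relation. [folklore] -/
theorem isRelation_relCoeff : W.IsRelation S hS (W.relCoeff hS) := (exists_isRelation hS).choose_spec.2

variable [PerfectField K]
variable (hstab : ∀ (σ : Field.absoluteGaloisGroup K) (P : W.geomPoints), P ∈ S → σ • P ∈ S)

/-- **The coefficients descended to `K`** (`IsRelation.mem_range_algebraMap`). [folklore] -/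
def relCoeffK (i : Fin 6) : K :=
  ((isRelation_relCoeff hS).mem_range_algebraMap hS hstab i).choose

/-- `relCoeffK` maps to `relCoeff`. [folklore] -/
theorem algebraMap_relCoeffK (i : Fin 6) :
    algebraMap K (AlgebraicClosure K) (W.relCoeffK hS hstab i) = W.relCoeff hS i :=
  ((isRelation_relCoeff hS).mem_range_algebraMap hS hstab i).choose_spec

variable (W) in
/-- **The quotient curve `E/S` over `K`**: with `y_S² = c₀ x_S³ + c₁ x_S y_S + c₂ x_S² + c₃ y_S +
c₄ x_S + c₅` (`cᵢ ∈ K`), the coordinates `X = c₀ x_S`, `Y = c₀ y_S` satisfy the Weierstrass equation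
`Y² - c₁ XY - c₀c₃ Y = X³ + c₂ X² + c₀c₄ X + c₀²c₅`. Silverman, *AEC*, Prop. III.4.12 and
Rem. III.4.13.2 (`E/Φ` is defined over `K` for `Φ` Galois-stable); Vélu (1971) for explicit
equations. [cite: SilvermanAEC2009, Prop. III.4.12] -/
def quotCurve (S : AddSubgroup W.geomPoints) (hS : (S : Set W.geomPoints).Finite)
    (hstab : ∀ (σ : Field.absoluteGaloisGroup K) (P : W.geomPoints), P ∈ S → σ • P ∈ S) :
    WeierstrassCurve K where
  a₁ := -W.relCoeffK hS hstab 1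
  a₂ := W.relCoeffK hS hstab 2
  a₃ := -(W.relCoeffK hS hstab 0 * W.relCoeffK hS hstab 3)
  a₄ := W.relCoeffK hS hstab 0 * W.relCoeffK hS hstab 4
  a₆ := W.relCoeffK hS hstab 0 ^ 2 * W.relCoeffK hS hstab 5

variable (W) in
/-- **The coordinate `X = c₀ x_S ∈ K̄(E)` of the quotient map.** [folklore] -/
def quotX (S : AddSubgroup W.geomPoints) (hS : (S : Set W.geomPoints).Finite) : W.geomFunctionField :=
  algebraMap (AlgebraicClosure K) W.geomFunctionField (W.relCoeff hS 0) * W.trX S hS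

variable (W) in
/-- **The coordinate `Y = c₀ y_S ∈ K̄(E)` of the quotient map.** [folklore] -/
def quotY (S : AddSubgroup W.geomPoints) (hS : (S : Set W.geomPoints).Finite) : W.geomFunctionField :=
  algebraMap (AlgebraicClosure K) W.geomFunctionField (W.relCoeff hS 0) * W.trY S hS

omit [PerfectField K] in
/-- `X` is `S`-invariant. [folklore] -/
theorem transAlgHom_quotX {u : W.geomPoints} (hu : u ∈ S) : W.transAlgHom u (W.quotX S hS) = W.quotX S hS := by
  rw [quotX, map_mul, AlgHom.commutes, transAlgHom_trX hS hu]

omit [PerfectField K] in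
/-- `Y` is `S`-invariant. [folklore] -/
theorem transAlgHom_quotY {u : W.geomPoints} (hu : u ∈ S) : W.transAlgHom u (W.quotY S hS) = W.quotY S hS := by
  rw [quotY, map_mul, AlgHom.commutes, transAlgHom_trY hS hu]

omit [PerfectField K] in
/-- `X ≠ 0`. [folklore] -/
theorem quotX_ne_zero : W.quotX S hS ≠ 0 :=
  mul_ne_zero ((_root_.map_ne_zero _).mpr (relCoeff_zero_ne_zero hS)) (trX_ne_zero hS)

omit [PerfectField K] in
/-- `Y ≠ 0`. [folklore] -/
theorem quotY_ne_zero : W.quotY S hS ≠ 0 :=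
  mul_ne_zero ((_root_.map_ne_zero _).mpr (relCoeff_zero_ne_zero hS)) (trY_ne_zero hS)

omit [PerfectField K] in
/-- `ord_P(X) = ord_P(x_S)`. [folklore] -/
theorem ord_quotX (P : W.geomPoints) :
    ord (W.baseChange (AlgebraicClosure K)).toAffine P (W.quotX S hS) =
      ord (W.baseChange (AlgebraicClosure K)).toAffine P (W.trX S hS) := by
  rw [quotX, ord_mul P ((_root_.map_ne_zero _).mpr (relCoeff_zero_ne_zero hS)) (trX_ne_zero hS),
    ord_algebraMap, zero_add]

omit [PerfectField K] in
/-- `ord_P(Y) = ord_P(y_S)`. [folklore] -/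
theorem ord_quotY (P : W.geomPoints) :
    ord (W.baseChange (AlgebraicClosure K)).toAffine P (W.quotY S hS) =
      ord (W.baseChange (AlgebraicClosure K)).toAffine P (W.trY S hS) := by
  rw [quotY, ord_mul P ((_root_.map_ne_zero _).mpr (relCoeff_zero_ne_zero hS)) (trY_ne_zero hS),
    ord_algebraMap, zero_add]

omit [PerfectField K] in
/-- `v_P(X) ≤ 1` off `S`. [folklore] -/
theorem placeValuation_quotX_le_one {P : W.geomPoints} (hP : P ∉ S) :
    placeValuation (W.baseChange (AlgebraicClosure K)).toAffine P (W.quotX S hS) ≤ 1 := by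
  rw [placeValuation_le_one_iff_ord_nonneg P (quotX_ne_zero hS), ord_quotX]
  exact ord_trX_nonneg hS hP

omit [PerfectField K] in
/-- `v_P(Y) ≤ 1` off `S`. [folklore] -/
theorem placeValuation_quotY_le_one {P : W.geomPoints} (hP : P ∉ S) :
    placeValuation (W.baseChange (AlgebraicClosure K)).toAffine P (W.quotY S hS) ≤ 1 := by
  rw [placeValuation_le_one_iff_ord_nonneg P (quotY_ne_zero hS), ord_quotY]
  exact ord_trY_nonneg hS hP

omit [PerfectField K] in
/-- `1 < v_P(X)` iff `P ∈ S`. [folklore] -/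
theorem one_lt_placeValuation_quotX_iff (P : W.geomPoints) :
    1 < placeValuation (W.baseChange (AlgebraicClosure K)).toAffine P (W.quotX S hS) ↔ P ∈ S := by
  rw [one_lt_placeValuation_iff_ord_neg P (quotX_ne_zero hS), ord_quotX,
    ← one_lt_placeValuation_iff_ord_neg P (trX_ne_zero hS)]
  exact one_lt_placeValuation_trX_iff hS P

omit [PerfectField K] in
/-- **The values of `X` off `S`: `X(P) = c₀ Σ_s x(P + s)`.** [folklore] -/
theorem hasValueAt_quotX {P : W.geomPoints} (hP : P ∉ S) :
    W.HasValueAt (W.quotX S hS) P (W.relCoeff hS 0 * ∑ s ∈ hS.toFinset, xy (P + s) 0) :=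
  (hasValueAt_algebraMap _ P).mul (hasValueAt_trX hS hP)

omit [PerfectField K] in
/-- **The values of `Y` off `S`: `Y(P) = c₀ Σ_s y(P + s)`.** [folklore] -/
theorem hasValueAt_quotY {P : W.geomPoints} (hP : P ∉ S) :
    W.HasValueAt (W.quotY S hS) P (W.relCoeff hS 0 * ∑ s ∈ hS.toFinset, xy (P + s) 1) :=
  (hasValueAt_algebraMap _ P).mul (hasValueAt_trY hS hP)

/-- The coefficients of `E/S` over `K̄(E)` are the constants `-c₁, c₂, -c₀c₃, c₀c₄, c₀²c₅`.
[folklore] -/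
theorem quotCurve_baseChange_a :
    ((W.quotCurve S hS hstab).baseChange W.geomFunctionField).a₁ =
        -algebraMap _ W.geomFunctionField (W.relCoeff hS 1) ∧
    ((W.quotCurve S hS hstab).baseChange W.geomFunctionField).a₂ =
        algebraMap _ W.geomFunctionField (W.relCoeff hS 2) ∧
    ((W.quotCurve S hS hstab).baseChange W.geomFunctionField).a₃ =
        -(algebraMap _ W.geomFunctionField (W.relCoeff hS 0) *
          algebraMap _ W.geomFunctionField (W.relCoeff hS 3)) ∧
    ((W.quotCurve S hS hstab).baseChange W.geomFunctionField).a₄ =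
        algebraMap _ W.geomFunctionField (W.relCoeff hS 0) *
          algebraMap _ W.geomFunctionField (W.relCoeff hS 4) ∧
    ((W.quotCurve S hS hstab).baseChange W.geomFunctionField).a₆ =
        algebraMap _ W.geomFunctionField (W.relCoeff hS 0) ^ 2 *
          algebraMap _ W.geomFunctionField (W.relCoeff hS 5) := by
  have h : ∀ i, algebraMap K W.geomFunctionField (W.relCoeffK hS hstab i) =
      algebraMap (AlgebraicClosure K) W.geomFunctionField (W.relCoeff hS i) := fun i ↦ by
    rw [IsScalarTower.algebraMap_apply K (AlgebraicClosure K) W.geomFunctionField, algebraMap_relCoeffK]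
  simp only [quotCurve, baseChange, map, map_neg, map_mul, map_pow, h]
  simp

/-- **`(X, Y)` satisfies the equation of `E/S`** over `K̄(E)`. [folklore] -/
theorem equation_quotX_quotY :
    ((W.quotCurve S hS hstab).baseChange W.geomFunctionField).toAffine.Equation
      (W.quotX S hS) (W.quotY S hS) := by
  obtain ⟨h1, h2, h3, h4, h6⟩ := quotCurve_baseChange_a hS hstab
  rw [Affine.equation_iff, h1, h2, h3, h4, h6, quotX, quotY]
  have hrel := isRelation_relCoeff hS
  rw [IsRelation, Fin.sum_univ_six] at hrel
  simp only [quotMono, Matrix.cons_val_zero, Matrix.cons_val_one, Matrix.cons_val, Algebra.smul_def,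
    mul_one] at hrel
  linear_combination (algebraMap (AlgebraicClosure K) W.geomFunctionField (W.relCoeff hS 0)) ^ 2 * hrel

end QuotCurve

end WeierstrassCurve


namespace WeierstrassCurve

open _root_.WeierstrassCurve.geomPoints Literature.NumberTheory.EllipticCurves.WeierstrassFunctionField

variable {K : Type u} [Field K] {W : WeierstrassCurve K} [W.IsElliptic]
variable {S : AddSubgroup W.geomPoints} (hS : (S : Set W.geomPoints).Finite)
variable [PerfectField K]
variable (hstab : ∀ (σ : Field.absoluteGaloisGroup K) (P : W.geomPoints), P ∈ S → σ • P ∈ S)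

/-! ## Step D: `E/S` is nonsingular -/

section Nonsingular

/-- **`Δ(E/S) ≠ 0`.** If `Δ = 0`, the cubic has a singular point `(x₀, y₀)` over `K̄` with tangent
slopes `α₁, α₂` (tree's `exists_singularPoint`, `eq_singularModel`), and in `K̄(E)` the relation
reads `ξ = (t - α₁)(t - α₂)` for `ξ = X - x₀`, `t = (Y - y₀)/ξ`; so `t` is an `S`-invariant
function with a simple pole at each point of `S` (`ord ξ = -2` there) and no other poles — which
`not_simplePoleOrbit` forbids (`K̄(E)^S` would be the rational field `K̄(t)`). Silverman, *AEC*,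
Prop. III.4.12 (`E/Φ` is an elliptic curve); cf. the proof of Prop. III.3.1(c). [folklore] -/
theorem quotCurve_Δ_ne_zero : (W.quotCurve S hS hstab).Δ ≠ 0 := by
  intro hΔ
  have hΔ' : ((W.quotCurve S hS hstab).baseChange (AlgebraicClosure K)).Δ = 0 := by
    rw [baseChange, map_Δ, hΔ, map_zero]
  obtain ⟨x₀, y₀, hE, hX, hY⟩ := exists_singularPoint _ hΔ'
  obtain ⟨α₁, α₂, hs, hp⟩ := exists_tangentSlopes ((W.quotCurve S hS hstab).baseChange (AlgebraicClosure K)) x₀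
  have hmodel := eq_singularModel _ hE hX hY hs hp
  -- the coefficients of `E/S` over `K̄` in terms of the singular point
  have hcoef : ((W.quotCurve S hS hstab).baseChange (AlgebraicClosure K)).a₁ = -W.relCoeff hS 1 ∧
      ((W.quotCurve S hS hstab).baseChange (AlgebraicClosure K)).a₂ = W.relCoeff hS 2 ∧
      ((W.quotCurve S hS hstab).baseChange (AlgebraicClosure K)).a₃ = -(W.relCoeff hS 0 * W.relCoeff hS 3) ∧
      ((W.quotCurve S hS hstab).baseChange (AlgebraicClosure K)).a₄ = W.relCoeff hS 0 * W.relCoeff hS 4 ∧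
      ((W.quotCurve S hS hstab).baseChange (AlgebraicClosure K)).a₆ = W.relCoeff hS 0 ^ 2 * W.relCoeff hS 5 := by
    simp only [quotCurve, baseChange, map, map_neg, map_mul, map_pow, algebraMap_relCoeffK]
    simp
  obtain ⟨e1, e2, e3, e4, e6⟩ := hcoef
  rw [hmodel] at e1 e2 e3 e4 e6
  simp only [singularModel.a₁_eq, singularModel.a₂_eq, singularModel.a₃_eq, singularModel.a₄_eq,
    singularModel.a₆_eq] at e1 e2 e3 e4 e6
  -- the relation over `K̄(E)`
  have heq := equation_quotX_quotY hS hstab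
  obtain ⟨h1, h2, h3, h4, h6⟩ := quotCurve_baseChange_a hS hstab
  rw [Affine.equation_iff, h1, h2, h3, h4, h6, ← map_mul, ← map_pow, ← map_mul, ← map_mul, ← e2, ← e4, ← e6,
    show W.relCoeff hS 1 = α₁ + α₂ by linear_combination e1,
    show W.relCoeff hS 0 * W.relCoeff hS 3 = -(-2 * y₀ + (α₁ + α₂) * x₀) by linear_combination e3] at heq
  simp only [map_neg, map_add, map_sub, map_mul, map_pow, map_ofNat] at heq
  set C := algebraMap (AlgebraicClosure K) W.geomFunctionField with hC
  set Xq := W.quotX S hS with hXq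
  set Yq := W.quotY S hS with hYq
  -- `ξ = X - x₀`, `t = (Y - y₀)/ξ`, `ξ = (t - α₁)(t - α₂)`
  set ξ := Xq - C x₀ with hξ
  have hX0 : Xq ≠ 0 := quotX_ne_zero hS
  have hoX : ∀ s ∈ S, ord (W.baseChange (AlgebraicClosure K)).toAffine s Xq = -2 := fun s hs ↦ by
    rw [ord_quotX, ord_trX_of_mem hS hs]
  have hoξ : ∀ s ∈ S, ord (W.baseChange (AlgebraicClosure K)).toAffine s ξ = -2 := fun s hs ↦ by
    rw [hξ, ord_sub_algebraMap_of_neg s hX0 (by rw [hoX s hs]; norm_num), hoX s hs]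
  have hξ0 : ξ ≠ 0 := fun h0 ↦ by
    have := hoξ 0 S.zero_mem
    rw [h0] at this; simp [ord] at this
  set t := (Yq - C y₀) / ξ with ht
  have hYt : Yq - C y₀ = t * ξ := by rw [ht, div_mul_cancel₀ _ hξ0]
  have hfac : ξ = (t - C α₁) * (t - C α₂) := by
    have h1 : ξ ^ 2 * ((t - C α₁) * (t - C α₂) - ξ) = 0 := by
      have : Xq = ξ + C x₀ := by rw [hξ, sub_add_cancel]
      rw [this] at heq
      have hY' : Yq = t * ξ + C y₀ := by rw [← hYt, sub_add_cancel]
      rw [hY'] at heq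
      linear_combination heq
    rcases mul_eq_zero.mp h1 with h | h
    · exact absurd (pow_eq_zero_iff two_ne_zero |>.mp h) hξ0
    · exact (sub_eq_zero.mp h).symm
  have ht1 : t - C α₁ ≠ 0 := fun h ↦ hξ0 (by rw [hfac, h, zero_mul])
  have ht2 : t - C α₂ ≠ 0 := fun h ↦ hξ0 (by rw [hfac, h, mul_zero])
  have ht0 : t ≠ 0 := by
    intro h0
    have := hoξ 0 S.zero_mem
    rw [hfac, h0, zero_sub, zero_sub, neg_mul_neg, ← map_mul, ord_algebraMap] at this
    norm_num at this
  -- `t` is `S`-invariant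
  have htinv : ∀ s ∈ S, W.transAlgHom s t = t := fun s hs ↦ by
    simp only [ht, hξ, hXq, hYq, map_div₀, map_sub, transAlgHom_quotX hS hs,
      transAlgHom_quotY hS hs, hC, AlgHom.commutes]
  -- orders of `t`: `-1` on `S`, `≥ 0` off `S`
  have hordfac : ∀ P : W.geomPoints, ord (W.baseChange (AlgebraicClosure K)).toAffine P t < 0 →
      ord (W.baseChange (AlgebraicClosure K)).toAffine P ξ =
        2 * ord (W.baseChange (AlgebraicClosure K)).toAffine P t := by
    intro P hneg
    rw [hfac, ord_mul P ht1 ht2, ord_sub_algebraMap_of_neg P ht0 hneg,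
      ord_sub_algebraMap_of_neg P ht0 hneg]
    ring
  have hpole : ∀ s ∈ S, ord (W.baseChange (AlgebraicClosure K)).toAffine ((0 : W.geomPoints) + s) t = -1 := by
    intro s hs
    rw [zero_add]
    by_cases hneg : ord (W.baseChange (AlgebraicClosure K)).toAffine s t < 0
    · have := hordfac s hneg
      rw [hoξ s hs] at this
      omega
    · exfalso
      push Not at hneg
      -- `t` integral at `s` forces `ξ` integral at `s`
      have h1 : placeValuation (W.baseChange (AlgebraicClosure K)).toAffine s (t - C α₁) ≤ 1 := by
        refine (Valuation.map_sub _ _ _).trans (max_le ?_ ?_)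
        · exact (placeValuation_le_one_iff_ord_nonneg s ht0).mpr hneg
        · by_cases h : α₁ = 0
          · simp [hC, h]
          · exact (placeValuation_algebraMap s h).le
      have h2 : placeValuation (W.baseChange (AlgebraicClosure K)).toAffine s (t - C α₂) ≤ 1 := by
        refine (Valuation.map_sub _ _ _).trans (max_le ?_ ?_)
        · exact (placeValuation_le_one_iff_ord_nonneg s ht0).mpr hneg
        · by_cases h : α₂ = 0
          · simp [hC, h]
          · exact (placeValuation_algebraMap s h).le
      have h3 : placeValuation (W.baseChange (AlgebraicClosure K)).toAffine s ξ ≤ 1 := by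
        rw [hfac, map_mul]; exact mul_le_one' h1 h2
      rw [placeValuation_le_one_iff_ord_nonneg s hξ0, hoξ s hs] at h3
      norm_num at h3
  have hreg : ∀ P : W.geomPoints, P - 0 ∉ S → 0 ≤ ord (W.baseChange (AlgebraicClosure K)).toAffine P t := by
    intro P hP
    rw [sub_zero] at hP
    by_contra hneg
    push Not at hneg
    have h1 := hordfac P hneg
    have h2 : 0 ≤ ord (W.baseChange (AlgebraicClosure K)).toAffine P ξ := by
      refine (placeValuation_le_one_iff_ord_nonneg P hξ0).mp ?_
      refine (Valuation.map_sub _ _ _).trans (max_le (placeValuation_quotX_le_one hS hP) ?_)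
      by_cases h : x₀ = 0
      · simp [hC, h]
      · exact (placeValuation_algebraMap P h).le
    omega
  exact not_simplePoleOrbit hS ht0 htinv 0 hpole hreg

/-- **`E/S` is an elliptic curve.** [cite: SilvermanAEC2009, Prop. III.4.12] -/
theorem isElliptic_quotCurve : (W.quotCurve S hS hstab).IsElliptic :=
  ⟨isUnit_iff_ne_zero.mpr (quotCurve_Δ_ne_zero hS hstab)⟩

end Nonsingular

end WeierstrassCurve


namespace WeierstrassCurve

open _root_.WeierstrassCurve.geomPoints Literature.NumberTheory.EllipticCurves.WeierstrassFunctionField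

variable {K : Type u} [Field K] {W : WeierstrassCurve K} [W.IsElliptic]
variable {S : AddSubgroup W.geomPoints} (hS : (S : Set W.geomPoints).Finite)
variable [PerfectField K]
variable (hstab : ∀ (σ : Field.absoluteGaloisGroup K) (P : W.geomPoints), P ∈ S → σ • P ∈ S)

/-! ## Step E: the quotient map `E → E/S` -/

section QuotMap

/-- `E/S` is an elliptic curve (instance form of `isElliptic_quotCurve`). [folklore] -/
instance instIsEllipticQuotCurve {S : AddSubgroup W.geomPoints} {hS : (S : Set W.geomPoints).Finite}
    {hstab : ∀ (σ : Field.absoluteGaloisGroup K) (P : W.geomPoints), P ∈ S → σ • P ∈ S} :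
    (W.quotCurve S hS hstab).IsElliptic :=
  isElliptic_quotCurve hS hstab

/-- `(X, Y)` is a nonsingular point of `E/S` over `K̄(E)`. [folklore] -/
theorem nonsingular_quotX_quotY :
    (((W.quotCurve S hS hstab).baseChange (AlgebraicClosure K)).toAffine.baseChange
      W.geomFunctionField).toAffine.Nonsingular (W.quotX S hS) (W.quotY S hS) :=
  (Affine.equation_iff_nonsingular (W := (W.quotCurve S hS hstab).baseChange W.geomFunctionField)).mp
    (equation_quotX_quotY hS hstab)

/-- **The generic image `(X, Y) ∈ (E/S)(K̄(E))`**, the `K̄(E)`-point of `E/S` defining the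
quotient map (an `L`-point of `FunctionFieldLPoints`). [folklore] -/
def quotLPoint : (((W.quotCurve S hS hstab).baseChange (AlgebraicClosure K)).toAffine.baseChange
    W.geomFunctionField).toAffine.Point :=
  .some (W.quotX S hS) (W.quotY S hS) (nonsingular_quotX_quotY hS hstab)

omit [PerfectField K] in
/-- `X` is transcendental over `K̄` (it has a pole). [folklore] -/
theorem transcendental_quotX : Transcendental (AlgebraicClosure K) (W.quotX S hS) := by
  intro halg
  obtain ⟨a, ha⟩ := exists_algebraMap_eq_of_isAlgebraic halg
  have h1 := ord_quotX hS (0 : W.geomPoints)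
  rw [ord_trX_of_mem hS S.zero_mem, ← ha, ord_algebraMap] at h1
  norm_num at h1

/-- **The quotient map `E(K̄) → (E/S)(K̄)` on points**: the specialisation of the generic image
`(X, Y)` at the place `P` (Silverman, *AEC*, II.2.1: the rational map `P ↦ (X(P), Y(P))`
extends to a morphism; `P ↦ O` at the poles of `X`, i.e. on `S`). [folklore] -/
def quotFun (P : W.geomPoints) : (W.quotCurve S hS hstab).geomPoints :=
  specialize (W.baseChange (AlgebraicClosure K)).toAffine
    ((W.quotCurve S hS hstab).baseChange (AlgebraicClosure K)).toAffine P (W.quotLPoint hS hstab)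

/-- **`quotFun P = O ↔ P ∈ S`** (the poles of `X` are the points of `S`). [folklore] -/
theorem quotFun_eq_zero_iff (P : W.geomPoints) : W.quotFun hS hstab P = 0 ↔ P ∈ S :=
  (specialize_some_eq_zero_iff (V := (W.baseChange (AlgebraicClosure K)).toAffine)
    (V' := ((W.quotCurve S hS hstab).baseChange (AlgebraicClosure K)).toAffine) P
    (nonsingular_quotX_quotY hS hstab)).trans (one_lt_placeValuation_quotX_iff hS P)

/-- **The coordinates of `quotFun P` off `S`**: `x = c₀ Σ_s x(P + s)`, `y = c₀ Σ_s y(P + s)`.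
[folklore] -/
theorem xy_quotFun {P : W.geomPoints} (hP : P ∉ S) :
    W.quotFun hS hstab P ≠ 0 ∧
    xy (W.quotFun hS hstab P) 0 = W.relCoeff hS 0 * ∑ s ∈ hS.toFinset, xy (P + s) 0 ∧
    xy (W.quotFun hS hstab P) 1 = W.relCoeff hS 0 * ∑ s ∈ hS.toFinset, xy (P + s) 1 := by
  have hP0 : P ≠ 0 := fun h ↦ hP (h ▸ S.zero_mem)
  have hle := placeValuation_quotX_le_one hS hP
  have hx := (hasValueAt_quotX hS hP).placeRes_eq hP0
  have hy := (hasValueAt_quotY hS hP).placeRes_eq hP0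
  rw [quotFun, quotLPoint, specialize_some_of_le_one _ _ hle]
  refine ⟨Affine.Point.some_ne_zero _, ?_, ?_⟩
  · change (![_, _] : Fin 2 → AlgebraicClosure K) 0 = _
    simpa using hx
  · change (![_, _] : Fin 2 → AlgebraicClosure K) 1 = _
    simpa using hy

/-- **`quotFun` is constant on `S`-cosets.** [folklore] -/
theorem quotFun_add_of_mem (P : W.geomPoints) {u : W.geomPoints} (hu : u ∈ S) :
    W.quotFun hS hstab (P + u) = W.quotFun hS hstab P := by
  by_cases hP : P ∈ S
  · rw [(quotFun_eq_zero_iff hS hstab _).mpr (S.add_mem hP hu), (quotFun_eq_zero_iff hS hstab _).mpr hP]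
  · have hPu : P + u ∉ S := fun h ↦ hP (by simpa using S.sub_mem h hu)
    obtain ⟨h0, hx, hy⟩ := xy_quotFun hS hstab hP
    obtain ⟨h0', hx', hy'⟩ := xy_quotFun hS hstab hPu
    refine eq_of_xy_eq h0' h0 (funext fun i ↦ ?_)
    have hre : ∀ i : Fin 2, ∑ s ∈ hS.toFinset, xy (P + u + s) i = ∑ s ∈ hS.toFinset, xy (P + s) i := by
      intro i
      simp_rw [add_assoc]
      exact sum_toFinset_add_left hS hu fun Q ↦ xy (P + Q) i
    fin_cases i
    · exact hx'.trans ((congrArg _ (hre 0)).trans hx.symm)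
    · exact hy'.trans ((congrArg _ (hre 1)).trans hy.symm)

/-- The ramification index of the quotient map at `P`. [folklore] -/
def quotRam (P : W.geomPoints) : ℕ :=
  ramificationIdx (W.baseChange (AlgebraicClosure K)).toAffine
    ((W.quotCurve S hS hstab).baseChange (AlgebraicClosure K)).toAffine P
    (nonsingular_quotX_quotY hS hstab) (transcendental_quotX hS)

/-- **The pull-back `K̄(E/S) → K̄(E)` along the quotient map** (`X ↦ X`, `Y ↦ Y`). [folklore] -/
def quotPullback : (W.quotCurve S hS hstab).geomFunctionField →ₐ[AlgebraicClosure K] W.geomFunctionField :=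
  pointPullback (V := (W.baseChange (AlgebraicClosure K)).toAffine)
    (V' := ((W.quotCurve S hS hstab).baseChange (AlgebraicClosure K)).toAffine)
    (nonsingular_quotX_quotY hS hstab).left (transcendental_quotX hS)

/-- The pull-back of `x'` is `X`. [folklore] -/
theorem quotPullback_genX : W.quotPullback hS hstab (W.quotCurve S hS hstab).genX = W.quotX S hS :=
  pointPullback_xF _ _

/-- The pull-back of `y'` is `Y`. [folklore] -/
theorem quotPullback_genY : W.quotPullback hS hstab (W.quotCurve S hS hstab).genY = W.quotY S hS :=
  pointPullback_yF _ _

/-- **`ord_P(φ^* t) = e(P) · ord_{φ P}(t)`** for the quotient map `φ`. [folklore] -/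
theorem ord_quotPullback_eq_mul (P : W.geomPoints) (t : (W.quotCurve S hS hstab).geomFunctionField) :
    ord (W.baseChange (AlgebraicClosure K)).toAffine P (W.quotPullback hS hstab t) =
      W.quotRam hS hstab P * ord ((W.quotCurve S hS hstab).baseChange (AlgebraicClosure K)).toAffine
        (W.quotFun hS hstab P) t :=
  ord_pointPullback _ _ _ t

/-- `e(P) ≥ 1`. [folklore] -/
theorem quotRam_pos (P : W.geomPoints) : 0 < W.quotRam hS hstab P := ramificationIdx_pos _ _ _

/-- **`e = 1` on `S`**: `ord_s(X) = -2 = e(s) · ord_O(x')`. [folklore] -/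
theorem quotRam_eq_one_of_mem {s : W.geomPoints} (hs : s ∈ S) : W.quotRam hS hstab s = 1 := by
  have h := ord_quotPullback_eq_mul hS hstab s (W.quotCurve S hS hstab).genX
  rw [quotPullback_genX, ord_quotX, ord_trX_of_mem hS hs, (quotFun_eq_zero_iff hS hstab s).mpr hs,
    ord_genX_zero] at h
  have := quotRam_pos hS hstab s
  omega

/-- **The pull-back lands in the `S`-invariants**: `τ_u^* ∘ φ^* = φ^*` for `u ∈ S`. [folklore] -/
theorem transAlgHom_quotPullback {u : W.geomPoints} (hu : u ∈ S) (t : (W.quotCurve S hS hstab).geomFunctionField) :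
    W.transAlgHom u (W.quotPullback hS hstab t) = W.quotPullback hS hstab t := by
  have : (W.transAlgHom u).comp (W.quotPullback hS hstab) = W.quotPullback hS hstab := by
    refine algHom_ext_xy ?_ ?_
    · change W.transAlgHom u (W.quotPullback hS hstab (W.quotCurve S hS hstab).genX) = _
      rw [quotPullback_genX, transAlgHom_quotX hS hu]
    · change W.transAlgHom u (W.quotPullback hS hstab (W.quotCurve S hS hstab).genY) = _
      rw [quotPullback_genY, transAlgHom_quotY hS hu]
  exact congrArg (fun f ↦ f t) this

end QuotMap

end WeierstrassCurve


namespace WeierstrassCurve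

open _root_.WeierstrassCurve.geomPoints Literature.NumberTheory.EllipticCurves.WeierstrassFunctionField

variable {K : Type u} [Field K] {W : WeierstrassCurve K} [W.IsElliptic]
variable {S : AddSubgroup W.geomPoints} (hS : (S : Set W.geomPoints).Finite)
variable [PerfectField K]
variable (hstab : ∀ (σ : Field.absoluteGaloisGroup K) (P : W.geomPoints), P ∈ S → σ • P ∈ S)

section Fibres

/-- The fibre of the quotient map over `Q`, a finite set of points of `E`. [folklore] -/
theorem finite_quotFibre (Q : (W.quotCurve S hS hstab).geomPoints) :
    {P : W.geomPoints | W.quotFun hS hstab P = Q}.Finite :=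
  finite_fibre_specialize (V := (W.baseChange (AlgebraicClosure K)).toAffine)
    (V' := ((W.quotCurve S hS hstab).baseChange (AlgebraicClosure K)).toAffine)
    (nonsingular_quotX_quotY hS hstab) (transcendental_quotX hS) Q

/-- The fibre degree of the quotient map over `Q` as a sum of ramification indices over the
fibre. [folklore] -/
theorem fibreDegree_quot_eq_sum (Q : (W.quotCurve S hS hstab).geomPoints) :
    fibreDegree (W.baseChange (AlgebraicClosure K)).toAffine
      ((W.quotCurve S hS hstab).baseChange (AlgebraicClosure K)).toAffine
      (nonsingular_quotX_quotY hS hstab) (transcendental_quotX hS) Q =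
      ∑ P ∈ (finite_quotFibre hS hstab Q).toFinset, W.quotRam hS hstab P :=
  fibreDegree_eq_sum _ _ Q

/-- **The fibre degree over `O` is `#S`**: the fibre is `S`, with `e = 1`. [folklore] -/
theorem fibreDegree_quot_zero :
    fibreDegree (W.baseChange (AlgebraicClosure K)).toAffine
      ((W.quotCurve S hS hstab).baseChange (AlgebraicClosure K)).toAffine
      (nonsingular_quotX_quotY hS hstab) (transcendental_quotX hS)
      (0 : (W.quotCurve S hS hstab).geomPoints) = hS.toFinset.card := by
  rw [fibreDegree_quot_eq_sum hS hstab 0]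
  have hset : (finite_quotFibre hS hstab 0).toFinset = hS.toFinset := by
    ext P
    rw [Set.Finite.mem_toFinset, Set.mem_setOf_eq, quotFun_eq_zero_iff, mem_finiteToFinset_iff]
  rw [hset, Finset.card_eq_sum_ones]
  exact Finset.sum_congr rfl fun s hs ↦ quotRam_eq_one_of_mem hS hstab ((mem_finiteToFinset_iff hS).mp hs)

/-- **All fibre degrees are `#S`** (constancy of the fibre degree, tree's
`fibreDegree_eq_fibreDegree_zero`, *AEC* II.2.6(a)). [folklore] -/
theorem fibreDegree_quot (Q : (W.quotCurve S hS hstab).geomPoints) :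
    fibreDegree (W.baseChange (AlgebraicClosure K)).toAffine
      ((W.quotCurve S hS hstab).baseChange (AlgebraicClosure K)).toAffine
      (nonsingular_quotX_quotY hS hstab) (transcendental_quotX hS) Q = hS.toFinset.card :=
  (fibreDegree_eq_fibreDegree_zero _ _ Q).trans (fibreDegree_quot_zero hS hstab)

/-- **The fibres of the quotient map are the `S`-cosets, with ramification `1`**: the coset
`P₁ + S` lies in the fibre of `φ P₁`, has `#S` elements, and the ramification indices (`≥ 1`)
over the fibre sum to `#S`. [folklore] -/
theorem quotFibre_eq_and_quotRam_eq_one (P₁ : W.geomPoints) :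
    (finite_quotFibre hS hstab (W.quotFun hS hstab P₁)).toFinset = hS.toFinset.image (P₁ + ·) ∧
    ∀ P ∈ (finite_quotFibre hS hstab (W.quotFun hS hstab P₁)).toFinset, W.quotRam hS hstab P = 1 := by
  set Fb := (finite_quotFibre hS hstab (W.quotFun hS hstab P₁)).toFinset with hFb
  set Orb := hS.toFinset.image (P₁ + ·) with hOrb
  have hsub : Orb ⊆ Fb := by
    intro P hP
    obtain ⟨s, hs, rfl⟩ := Finset.mem_image.mp hP
    rw [hFb, Set.Finite.mem_toFinset, Set.mem_setOf_eq]
    exact quotFun_add_of_mem hS hstab P₁ ((mem_finiteToFinset_iff hS).mp hs)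
  have hcardO : Orb.card = hS.toFinset.card := Finset.card_image_of_injective _ (add_right_injective P₁)
  have hsum : ∑ P ∈ Fb, W.quotRam hS hstab P = hS.toFinset.card := by
    rw [hFb, ← fibreDegree_quot_eq_sum]; exact fibreDegree_quot hS hstab _
  have hge : ∀ P ∈ Fb, 1 ≤ W.quotRam hS hstab P := fun P _ ↦ quotRam_pos hS hstab P
  have hcard_le : Fb.card ≤ hS.toFinset.card := by
    rw [← hsum, Finset.card_eq_sum_ones]
    exact Finset.sum_le_sum hge
  have heq : Fb = Orb := (Finset.eq_of_subset_of_card_le hsub (by rw [hcardO]; exact hcard_le)).symm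
  refine ⟨heq, ?_⟩
  have hsum1 : ∑ P ∈ Fb, (1 : ℕ) = ∑ P ∈ Fb, W.quotRam hS hstab P := by
    rw [hsum, ← Finset.card_eq_sum_ones, heq, hcardO]
  exact fun P hP ↦ ((Finset.sum_eq_sum_iff_of_le hge).mp hsum1 P hP).symm

/-- **The quotient map is unramified: `e(P) = 1`.** [folklore] -/
theorem quotRam_eq_one (P : W.geomPoints) : W.quotRam hS hstab P = 1 :=
  (quotFibre_eq_and_quotRam_eq_one hS hstab P).2 P (by
    rw [Set.Finite.mem_toFinset, Set.mem_setOf_eq])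

/-- **`φ P = φ P₁ ↔ P - P₁ ∈ S`**: the fibres of the quotient map are exactly the cosets of
`S`. Silverman, *AEC*, Prop. III.4.12 (`ker φ = Φ`) with Cor. III.4.9. [folklore] -/
theorem quotFun_eq_quotFun_iff (P P₁ : W.geomPoints) :
    W.quotFun hS hstab P = W.quotFun hS hstab P₁ ↔ P - P₁ ∈ S := by
  constructor
  · intro h
    have hmem : P ∈ (finite_quotFibre hS hstab (W.quotFun hS hstab P₁)).toFinset := by
      rw [Set.Finite.mem_toFinset, Set.mem_setOf_eq]; exact h
    rw [(quotFibre_eq_and_quotRam_eq_one hS hstab P₁).1, Finset.mem_image] at hmem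
    obtain ⟨s, hs, rfl⟩ := hmem
    rw [add_sub_cancel_left]; exact (mem_finiteToFinset_iff hS).mp hs
  · intro h
    rw [show P = P₁ + (P - P₁) by abel]
    exact quotFun_add_of_mem hS hstab P₁ h

/-- **The quotient map is onto `(E/S)(K̄) ∪ {O}`** (every fibre degree is `#S ≥ 1`).
Silverman, *AEC*, Thm. II.2.3. [folklore] -/
theorem quotFun_surjective : Function.Surjective (W.quotFun hS hstab) := by
  intro Q
  have hsum := (fibreDegree_quot_eq_sum hS hstab Q).symm.trans (fibreDegree_quot hS hstab Q)
  have hne : (finite_quotFibre hS hstab Q).toFinset.Nonempty := by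
    by_contra hemp
    rw [Finset.not_nonempty_iff_eq_empty] at hemp
    rw [hemp, Finset.sum_empty] at hsum
    exact Finset.card_ne_zero.mpr ⟨0, (mem_finiteToFinset_iff hS).mpr S.zero_mem⟩ hsum.symm
  obtain ⟨P, hP⟩ := hne
  rw [Set.Finite.mem_toFinset, Set.mem_setOf_eq] at hP
  exact ⟨P, hP⟩

/-- **`ord_P(φ^* t) = ord_{φ P}(t)`** for the quotient map (it is unramified). [folklore] -/
theorem ord_quotPullback (P : W.geomPoints) (t : (W.quotCurve S hS hstab).geomFunctionField) :
    ord (W.baseChange (AlgebraicClosure K)).toAffine P (W.quotPullback hS hstab t) =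
      ord ((W.quotCurve S hS hstab).baseChange (AlgebraicClosure K)).toAffine (W.quotFun hS hstab P) t := by
  rw [ord_quotPullback_eq_mul, quotRam_eq_one, Nat.cast_one, one_mul]

end Fibres

end WeierstrassCurve


namespace WeierstrassCurve

open _root_.WeierstrassCurve.geomPoints Literature.NumberTheory.EllipticCurves.WeierstrassFunctionField

variable {K : Type u} [Field K] {W : WeierstrassCurve K} [W.IsElliptic]
variable {S : AddSubgroup W.geomPoints} (hS : (S : Set W.geomPoints).Finite)

section Hom

omit [W.IsElliptic] in
/-- `Σ_{s ∈ S} [P + s = R] = [P - R ∈ S]`. [folklore] -/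
theorem sum_toFinset_ite_add_eq (P R : W.geomPoints) :
    ∑ s ∈ hS.toFinset, (if P + s = R then (1 : ℤ) else 0) = if P - R ∈ S then 1 else 0 := by
  by_cases h : P - R ∈ S
  · rw [if_pos h]
    have hmem : R - P ∈ hS.toFinset := (mem_finiteToFinset_iff hS).mpr (by simpa using S.neg_mem h)
    rw [Finset.sum_eq_single_of_mem (R - P) hmem (fun s _ hs ↦ if_neg fun h' ↦ hs (by rw [← h']; abel))]
    rw [if_pos (by abel)]
  · rw [if_neg h]
    refine Finset.sum_eq_zero fun s hs ↦ if_neg fun h' ↦ h ?_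
    have : P - R = -s := by rw [← h']; abel
    rw [this]; exact S.neg_mem ((mem_finiteToFinset_iff hS).mp hs)

omit [W.IsElliptic] in
/-- Products over a finite subgroup are invariant under translation of the index. [folklore] -/
theorem prod_toFinset_add_left {M : Type*} [CommMonoid M] {u : W.geomPoints} (hu : u ∈ S)
    (f : W.geomPoints → M) : ∏ s ∈ hS.toFinset, f (u + s) = ∏ s ∈ hS.toFinset, f s := by
  refine Finset.prod_nbij' (fun s ↦ u + s) (fun s ↦ s - u) ?_ ?_ ?_ ?_ ?_
  · intro s hs
    rw [mem_finiteToFinset_iff] at hs ⊢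
    exact S.add_mem hu hs
  · intro s hs
    rw [mem_finiteToFinset_iff] at hs ⊢
    exact S.sub_mem hs hu
  · intro s _; simp
  · intro s _; simp
  · intro s _; rfl

/-- **The norm `∏_{s ∈ S} τ_s^* f` is `S`-invariant.** [folklore] -/
theorem transAlgHom_prod_transAlgHom {u : W.geomPoints} (hu : u ∈ S) (f : W.geomFunctionField) :
    W.transAlgHom u (∏ s ∈ hS.toFinset, W.transAlgHom s f) = ∏ s ∈ hS.toFinset, W.transAlgHom s f := by
  rw [map_prod]
  simp_rw [← AlgHom.comp_apply, ← transAlgHom_add]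
  exact prod_toFinset_add_left hS hu fun s ↦ W.transAlgHom s f

/-- **The divisor of the norm of a function with divisor `(P₁) + (P₂) - (P₁ + P₂) - (O)`**:
`ord_P = [P - P₁ ∈ S] + [P - P₂ ∈ S] - [P - (P₁+P₂) ∈ S] - [P ∈ S]`. [folklore] -/
theorem ord_norm_eq {f : W.geomFunctionField} (hf0 : f ≠ 0) {P₁ P₂ : W.geomPoints}
    (hf : ∀ P : W.geomPoints, ord (W.baseChange (AlgebraicClosure K)).toAffine P f =
      ((if P = P₁ then (1 : ℤ) else 0) - (if P = P₁ + P₂ then (1 : ℤ) else 0)) +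
        ((if P = P₂ then (1 : ℤ) else 0) - (if P = 0 then (1 : ℤ) else 0)))
    (P : W.geomPoints) :
    ord (W.baseChange (AlgebraicClosure K)).toAffine P (∏ s ∈ hS.toFinset, W.transAlgHom s f) =
      (if P - P₁ ∈ S then 1 else 0) + (if P - P₂ ∈ S then 1 else 0) -
        (if P - (P₁ + P₂) ∈ S then 1 else 0) - (if P - 0 ∈ S then 1 else 0) := by
  rw [ord_prod_transAlgHom _ hf0]
  simp_rw [hf]
  rw [Finset.sum_add_distrib, Finset.sum_sub_distrib, Finset.sum_sub_distrib,
    sum_toFinset_ite_add_eq, sum_toFinset_ite_add_eq, sum_toFinset_ite_add_eq, sum_toFinset_ite_add_eq]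
  ring

variable [PerfectField K]
variable (hstab : ∀ (σ : Field.absoluteGaloisGroup K) (P : W.geomPoints), P ∈ S → σ • P ∈ S)

/-- **The quotient map is a group homomorphism** (Silverman, *AEC*, Thm. III.4.8 for this
morphism, proved through divisors as there but with the fixed field in place of `Pic⁰`): if
`φ(P₁ + P₂) ≠ φ P₁ + φ P₂ = φ P₃`, take `f ∈ K̄(E)` with `div f = (P₁) + (P₂) - (P₁+P₂) - (O)`
and `f' ∈ K̄(E/S)` with `div f' = (φP₁) + (φP₂) - (φP₁ + φP₂) - (O)` (*AEC* III.3.5 ⇐, tree's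
`exists_ord_eq_of_pairs`); then `φ^* f' / ∏_s τ_s^* f` is an `S`-invariant function whose divisor
is `Σ_s (P₁ + P₂ + s) - Σ_s (P₃ + s)`, contradicting `not_simplePoleOrbit`.
[cite: SilvermanAEC2009, Thm. III.4.8] -/
theorem quotFun_add (P₁ P₂ : W.geomPoints) :
    W.quotFun hS hstab (P₁ + P₂) = W.quotFun hS hstab P₁ + W.quotFun hS hstab P₂ := by
  by_contra hne
  obtain ⟨P₃, hP₃⟩ := quotFun_surjective hS hstab (W.quotFun hS hstab P₁ + W.quotFun hS hstab P₂)
  have hP₃' : P₃ - (P₁ + P₂) ∉ S := fun h ↦ hne (by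
    rw [← hP₃]; exact ((quotFun_eq_quotFun_iff hS hstab _ _).mpr (by simpa using S.neg_mem h)))
  -- the two functions
  obtain ⟨f, hf0, hf⟩ := exists_ord_eq_of_pairs (W := W) Finset.univ ![P₁, P₂] ![P₁ + P₂, 0] (by
    rw [Fin.sum_univ_two]; simp only [Matrix.cons_val_zero, Matrix.cons_val_one]; abel)
  obtain ⟨f', hf0', hf'⟩ := exists_ord_eq_of_pairs (W := W.quotCurve S hS hstab) Finset.univ
    ![W.quotFun hS hstab P₁, W.quotFun hS hstab P₂] ![W.quotFun hS hstab P₁ + W.quotFun hS hstab P₂, 0] (by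
    rw [Fin.sum_univ_two]; simp only [Matrix.cons_val_zero, Matrix.cons_val_one]; abel)
  have hf1 : ∀ P : W.geomPoints, ord (W.baseChange (AlgebraicClosure K)).toAffine P f =
      ((if P = P₁ then (1 : ℤ) else 0) - (if P = P₁ + P₂ then (1 : ℤ) else 0)) +
        ((if P = P₂ then (1 : ℤ) else 0) - (if P = 0 then (1 : ℤ) else 0)) := fun P ↦ by
    rw [hf P, Fin.sum_univ_two]; rfl
  have hf1' : ∀ Q : (W.quotCurve S hS hstab).geomPoints,
      ord ((W.quotCurve S hS hstab).baseChange (AlgebraicClosure K)).toAffine Q f' =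
      ((if Q = W.quotFun hS hstab P₁ then (1 : ℤ) else 0) -
        (if Q = W.quotFun hS hstab P₁ + W.quotFun hS hstab P₂ then (1 : ℤ) else 0)) +
        ((if Q = W.quotFun hS hstab P₂ then (1 : ℤ) else 0) - (if Q = 0 then (1 : ℤ) else 0)) := fun Q ↦ by
    rw [hf' Q, Fin.sum_univ_two]; rfl
  set N := ∏ s ∈ hS.toFinset, W.transAlgHom s f with hN
  have hN0 : N ≠ 0 := prod_transAlgHom_ne_zero _ hf0
  have hι0 : W.quotPullback hS hstab f' ≠ 0 := (map_ne_zero_iff _ (W.quotPullback hS hstab).injective).mpr hf0'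
  set r := W.quotPullback hS hstab f' / N with hr
  have hr0 : r ≠ 0 := div_ne_zero hι0 hN0
  -- orders of `r`
  have hordι : ∀ P : W.geomPoints, ord (W.baseChange (AlgebraicClosure K)).toAffine P (W.quotPullback hS hstab f') =
      (if P - P₁ ∈ S then 1 else 0) + (if P - P₂ ∈ S then 1 else 0) -
        (if P - P₃ ∈ S then 1 else 0) - (if P - 0 ∈ S then 1 else 0) := by
    intro P
    rw [ord_quotPullback, hf1', ← hP₃]
    simp only [quotFun_eq_quotFun_iff hS hstab, quotFun_eq_zero_iff hS hstab, sub_zero]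
    ring
  have hordr : ∀ P : W.geomPoints, ord (W.baseChange (AlgebraicClosure K)).toAffine P r =
      (if P - (P₁ + P₂) ∈ S then 1 else 0) - (if P - P₃ ∈ S then 1 else 0) := by
    intro P
    rw [hr, ord_div P hι0 hN0, hordι, hN, ord_norm_eq hS hf0 hf1]
    ring
  -- invariance
  have hinv : ∀ s ∈ S, W.transAlgHom s r = r := fun s hs ↦ by
    rw [hr, map_div₀, transAlgHom_quotPullback hS hstab hs, hN, transAlgHom_prod_transAlgHom hS hs]
  refine not_simplePoleOrbit hS hr0 hinv P₃ (fun s hs ↦ ?_) (fun P hP ↦ ?_)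
  · rw [hordr, if_neg, if_pos (by simpa using hs)]
    · norm_num
    · intro h
      have := S.sub_mem h hs
      rw [show P₃ + s - (P₁ + P₂) - s = P₃ - (P₁ + P₂) by abel] at this
      exact hP₃' this
  · rw [hordr, if_neg hP, sub_zero]
    split_ifs <;> norm_num

end Hom

end WeierstrassCurve


namespace WeierstrassCurve

open _root_.WeierstrassCurve.geomPoints Literature.NumberTheory.EllipticCurves.WeierstrassFunctionField

variable {K : Type u} [Field K] {W : WeierstrassCurve K} [W.IsElliptic]
variable {S : AddSubgroup W.geomPoints} (hS : (S : Set W.geomPoints).Finite)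
variable [PerfectField K]
variable (hstab : ∀ (σ : Field.absoluteGaloisGroup K) (P : W.geomPoints), P ∈ S → σ • P ∈ S)

section IsogenyStructure

/-- **The quotient map is algebraic**: it agrees with the rational map `(X, Y) = (g₁/h₁, g₂/h₂)`
(any fractions representing `X, Y ∈ K̄(E)`) off `S` and the zeros of `h₁, h₂`. [folklore] -/
theorem isAlgebraicOn_quotFun : IsAlgebraicOn W (W.quotCurve S hS hstab) (W.quotFun hS hstab) := by
  obtain ⟨g₁, h₁, hh₁, hX⟩ := exists_eq_evalGeneric_div (W.quotX S hS)
  obtain ⟨g₂, h₂, hh₂, hY⟩ := exists_eq_evalGeneric_div (W.quotY S hS)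
  refine ⟨g₁, h₁, g₂, h₂, ?_⟩
  refine ((hS.union ((finite_setOf_eval_xy_eq_zero hh₁).union (finite_setOf_eval_xy_eq_zero hh₂))).union
    (Set.finite_singleton (0 : W.geomPoints))).subset fun P hP ↦ ?_
  rw [Set.mem_setOf_eq] at hP
  simp only [Set.mem_union, SetLike.mem_coe, Set.mem_setOf_eq, Set.mem_singleton_iff]
  by_contra hcon
  push Not at hcon
  obtain ⟨⟨hPS, h1, h2⟩, hP0⟩ := hcon
  have hh₁P : MvPolynomial.eval (xy P) h₁ ≠ 0 := h1 hP0
  have hh₂P : MvPolynomial.eval (xy P) h₂ ≠ 0 := h2 hP0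
  apply hP
  rw [agreesWithRationalMapAt_iff]
  refine ⟨hP0, hh₁P, hh₂P, ?_⟩
  obtain ⟨hq0, hqx, hqy⟩ := xy_quotFun hS hstab hPS
  -- the values of `X, Y` at `P` computed from the fractions
  have hvx : W.relCoeff hS 0 * ∑ s ∈ hS.toFinset, xy (P + s) 0 =
      MvPolynomial.eval (xy P) g₁ / MvPolynomial.eval (xy P) h₁ :=
    (hasValueAt_quotX hS hPS).unique hP0 (hX ▸ hasValueAt_div hP0 hh₁P)
  have hvy : W.relCoeff hS 0 * ∑ s ∈ hS.toFinset, xy (P + s) 1 =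
      MvPolynomial.eval (xy P) g₂ / MvPolynomial.eval (xy P) h₂ :=
    (hasValueAt_quotY hS hPS).unique hP0 (hY ▸ hasValueAt_div hP0 hh₂P)
  obtain ⟨a, b, hab, hq⟩ := geomPoints.exists_eq_some hq0
  rw [hq, xy_some] at hqx hqy
  simp only [Matrix.cons_val_zero, Matrix.cons_val_one] at hqx hqy
  rw [hvx] at hqx
  rw [hvy] at hqy
  subst hqx hqy
  exact ⟨hab, hq⟩

/-- **The quotient map commutes with `Γ_K`** (`S` is Galois-stable and `c₀ ∈ K`):
`φ(σ P) = σ φ(P)`. Silverman, *AEC*, Rem. III.4.13.2. [folklore] -/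
theorem quotFun_smul (σ : Field.absoluteGaloisGroup K) (P : W.geomPoints) :
    W.quotFun hS hstab (σ • P) = σ • W.quotFun hS hstab P := by
  by_cases hP : P ∈ S
  · rw [(quotFun_eq_zero_iff hS hstab _).mpr (hstab σ P hP), (quotFun_eq_zero_iff hS hstab _).mpr hP,
      smul_zero]
  · have hσP : σ • P ∉ S := fun h ↦ hP (by simpa using hstab σ⁻¹ _ h)
    obtain ⟨h0, hx, hy⟩ := xy_quotFun hS hstab hσP
    obtain ⟨h0', hx', hy'⟩ := xy_quotFun hS hstab hP
    have h0'' : σ • W.quotFun hS hstab P ≠ 0 := fun h ↦ h0' (by simpa using congrArg (σ⁻¹ • ·) h)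
    refine eq_of_xy_eq h0 h0'' (funext fun i ↦ ?_)
    rw [← geomPoints.xy_smul σ (W.quotFun hS hstab P) i]
    have hc : galAut K σ (W.relCoeff hS 0) = W.relCoeff hS 0 := by
      rw [← algebraMap_relCoeffK hS hstab 0, AlgEquiv.commutes]
    fin_cases i
    · change xy (W.quotFun hS hstab (σ • P)) 0 = galAut K σ (xy (W.quotFun hS hstab P) 0)
      rw [hx, hx', map_mul, hc, smul_sum_xy hS σ hstab P 0]
    · change xy (W.quotFun hS hstab (σ • P)) 1 = galAut K σ (xy (W.quotFun hS hstab P) 1)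
      rw [hy, hy', map_mul, hc, smul_sum_xy hS σ hstab P 1]

variable (W) in
/-- **The separable quotient isogeny `φ : E → E/S` over `K`** with kernel the finite
`Γ_K`-stable subgroup `S ⊆ E(K̄)` (a term of the prelude structure `WeierstrassCurve.Isogeny`:
the homomorphism `quotFun` on `K̄`-points, algebraic, `Γ_K`-equivariant, with finite kernel `S`).
Silverman, *AEC*, Prop. III.4.12 and Rem. III.4.13.2. [cite: SilvermanAEC2009, Prop. III.4.12] -/
def quotIsogeny (S : AddSubgroup W.geomPoints) (hS : (S : Set W.geomPoints).Finite)
    (hstab : ∀ (σ : Field.absoluteGaloisGroup K) (P : W.geomPoints), P ∈ S → σ • P ∈ S) :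
    Isogeny W (W.quotCurve S hS hstab) where
  toAddMonoidHom :=
    { toFun := W.quotFun hS hstab
      map_zero' := (quotFun_eq_zero_iff hS hstab 0).mpr S.zero_mem
      map_add' := quotFun_add hS hstab }
  isAlgebraic := isAlgebraicOn_quotFun hS hstab
  equivariant := quotFun_smul hS hstab
  finite_ker := hS.subset fun P hP ↦ (quotFun_eq_zero_iff hS hstab P).mp hP

/-- The quotient isogeny acts as `quotFun`. [folklore] -/
@[simp] theorem quotIsogeny_apply (P : W.geomPoints) : W.quotIsogeny S hS hstab P = W.quotFun hS hstab P := rfl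

/-- **`ker φ = S`.** [cite: SilvermanAEC2009, Prop. III.4.12] -/
theorem ker_quotIsogeny : (W.quotIsogeny S hS hstab).toAddMonoidHom.ker = S :=
  AddSubgroup.ext fun P ↦ quotFun_eq_zero_iff hS hstab P

end IsogenyStructure

end WeierstrassCurve


namespace WeierstrassCurve

open _root_.WeierstrassCurve.geomPoints Literature.NumberTheory.EllipticCurves.WeierstrassFunctionField

variable {K : Type u} [Field K] {W : WeierstrassCurve K} [W.IsElliptic]
variable {S : AddSubgroup W.geomPoints} (hS : (S : Set W.geomPoints).Finite)

section Degree

/-- `ord_P` of a finite product of non-zero functions is the sum of the orders. [folklore] -/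
theorem ord_finset_prod {ι : Type*} (s : Finset ι) {g : ι → W.geomFunctionField}
    (hg : ∀ i ∈ s, g i ≠ 0) (P : W.geomPoints) :
    ord (W.baseChange (AlgebraicClosure K)).toAffine P (∏ i ∈ s, g i) =
      ∑ i ∈ s, ord (W.baseChange (AlgebraicClosure K)).toAffine P (g i) := by
  induction s using Finset.induction_on with
  | empty => simp [ord]
  | insert i s hi ih =>
    rw [Finset.prod_insert hi, Finset.sum_insert hi,
      ord_mul P (hg i (Finset.mem_insert_self i s))
        (Finset.prod_ne_zero_iff.mpr fun j hj ↦ hg j (Finset.mem_insert_of_mem hj)),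
      ih fun j hj ↦ hg j (Finset.mem_insert_of_mem hj)]

/-- Every `n ≥ 2` is `2a + 3b`. [folklore] -/
theorem exists_two_mul_add_three_mul {n : ℕ} (hn : 2 ≤ n) : ∃ a b : ℕ, 2 * a + 3 * b = n := by
  rcases Nat.even_or_odd n with ⟨k, hk⟩ | ⟨k, hk⟩
  · exact ⟨k, 0, by omega⟩
  · exact ⟨k - 1, 1, by omega⟩

/-- **Invariant functions regular off `S` are polynomials in `X, Y`**: an `S`-invariant `h ∈ K̄(E)`
with `v_P(h) ≤ 1` for `P ∉ S` lies in `K̄[X, Y]` — by descending induction on the pole order at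
`O`, subtracting the leading term of the monomial `X^a Y^b` (`2a + 3b = -ord_O h`) when
`ord_O h ≤ -2`, while `ord_O h = -1` is excluded by `not_simplePoleOrbit` and `ord_O h ≥ 0` means
`h` is constant (`exists_eq_algebraMap_of_invariant`). Silverman, *AEC*, proof of
Prop. III.3.1(a)–(b) (`K(E) = K(x, y)` through `L(n(O))`), transposed to `E/S`. [folklore] -/
theorem mem_adjoin_of_invariant_of_regular (m : ℕ) :
    ∀ h : W.geomFunctionField, (∀ s ∈ S, W.transAlgHom s h = h) →
      (∀ P : W.geomPoints, P ∉ S → placeValuation (W.baseChange (AlgebraicClosure K)).toAffine P h ≤ 1) →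
      (h = 0 ∨ -(m : ℤ) ≤ ord (W.baseChange (AlgebraicClosure K)).toAffine (0 : W.geomPoints) h) →
      h ∈ Algebra.adjoin (AlgebraicClosure K) {W.quotX S hS, W.quotY S hS} := by
  -- constants
  have hconst : ∀ h : W.geomFunctionField, (∀ s ∈ S, W.transAlgHom s h = h) →
      (∀ P : W.geomPoints, P ∉ S → placeValuation (W.baseChange (AlgebraicClosure K)).toAffine P h ≤ 1) →
      (h = 0 ∨ (-1 : ℤ) ≤ ord (W.baseChange (AlgebraicClosure K)).toAffine (0 : W.geomPoints) h) →
      h ∈ Algebra.adjoin (AlgebraicClosure K) {W.quotX S hS, W.quotY S hS} := by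
    intro h hinv hreg hO
    obtain ⟨c, hc⟩ := exists_eq_algebraMap_of_invariant hS hinv (fun P hP ↦ by
      rcases eq_or_ne h 0 with rfl | hh
      · simp [ord]
      · exact (placeValuation_le_one_iff_ord_nonneg P hh).mp (hreg P hP)) hO
    rw [← hc]
    exact Subalgebra.algebraMap_mem _ c
  induction m with
  | zero =>
    intro h hinv hreg hO
    exact hconst h hinv hreg (hO.imp id fun h0 ↦ by omega)
  | succ m ih =>
    intro h hinv hreg hO
    by_cases hcase : h = 0 ∨ -(m : ℤ) ≤ ord (W.baseChange (AlgebraicClosure K)).toAffine (0 : W.geomPoints) h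
    · exact ih h hinv hreg hcase
    push Not at hcase
    obtain ⟨hh, hlt⟩ := hcase
    have hO' : ord (W.baseChange (AlgebraicClosure K)).toAffine (0 : W.geomPoints) h = -(m + 1 : ℤ) := by
      have := hO.resolve_left hh; omega
    by_cases hm : m = 0
    · subst hm
      exact hconst h hinv hreg (Or.inr (by rw [hO']; norm_num))
    -- the monomial `X^a Y^b` of order `-(m+1)` at `O`
    obtain ⟨a, b, hab⟩ := exists_two_mul_add_three_mul (n := m + 1) (by omega)
    set μ := W.quotX S hS ^ a * W.quotY S hS ^ b with hμ
    have hX0 := quotX_ne_zero hS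
    have hY0 := quotY_ne_zero hS
    have hμ0 : μ ≠ 0 := mul_ne_zero (pow_ne_zero a hX0) (pow_ne_zero b hY0)
    have hμord : ord (W.baseChange (AlgebraicClosure K)).toAffine (0 : W.geomPoints) μ = -(m + 1 : ℤ) := by
      rw [hμ, ord_mul _ (pow_ne_zero a hX0) (pow_ne_zero b hY0), ord_pow _ hX0, ord_pow _ hY0, ord_quotX,
        ord_quotY, ord_trX_of_mem hS S.zero_mem, ord_trY_of_mem hS S.zero_mem]
      omega
    obtain ⟨c, -, hc⟩ := exists_ord_sub_smul_gt (V := (W.baseChange (AlgebraicClosure K)).toAffine)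
      (0 : W.geomPoints) hh hμ0 (hO'.trans hμord.symm)
    set h' := h - algebraMap (AlgebraicClosure K) W.geomFunctionField c * μ with hh'
    have hμinv : ∀ s ∈ S, W.transAlgHom s μ = μ := fun s hs ↦ by
      rw [hμ, map_mul, map_pow, map_pow, transAlgHom_quotX hS hs, transAlgHom_quotY hS hs]
    have hinv' : ∀ s ∈ S, W.transAlgHom s h' = h' := fun s hs ↦ by
      rw [hh', map_sub, map_mul, AlgHom.commutes, hinv s hs, hμinv s hs]
    have hμreg : ∀ P : W.geomPoints, P ∉ S →
        placeValuation (W.baseChange (AlgebraicClosure K)).toAffine P μ ≤ 1 := fun P hP ↦ by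
      rw [hμ, map_mul, map_pow, map_pow]
      exact mul_le_one' (pow_le_one₀ zero_le (placeValuation_quotX_le_one hS hP))
        (pow_le_one₀ zero_le (placeValuation_quotY_le_one hS hP))
    have hcreg : ∀ P : W.geomPoints,
        placeValuation (W.baseChange (AlgebraicClosure K)).toAffine P
          (algebraMap (AlgebraicClosure K) W.geomFunctionField c) ≤ 1 := fun P ↦ by
      by_cases hc0 : c = 0
      · simp [hc0]
      · exact (placeValuation_algebraMap P hc0).le
    have hreg' : ∀ P : W.geomPoints, P ∉ S →
        placeValuation (W.baseChange (AlgebraicClosure K)).toAffine P h' ≤ 1 := fun P hP ↦ by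
      rw [hh']
      refine (Valuation.map_sub _ _ _).trans (max_le (hreg P hP) ?_)
      rw [map_mul]; exact mul_le_one' (hcreg P) (hμreg P hP)
    have hO'' : h' = 0 ∨ -(m : ℤ) ≤ ord (W.baseChange (AlgebraicClosure K)).toAffine (0 : W.geomPoints) h' := by
      refine hc.imp id fun hgt ↦ ?_
      change ord _ _ μ < ord _ _ h' at hgt
      rw [hμord] at hgt; omega
    have hmem' := ih h' hinv' hreg' hO''
    have hμmem : μ ∈ Algebra.adjoin (AlgebraicClosure K) {W.quotX S hS, W.quotY S hS} := by
      rw [hμ]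
      exact Subalgebra.mul_mem _ (Subalgebra.pow_mem _ (Algebra.subset_adjoin (by simp)) a)
        (Subalgebra.pow_mem _ (Algebra.subset_adjoin (by simp)) b)
    have : h = h' + algebraMap (AlgebraicClosure K) W.geomFunctionField c * μ := by rw [hh', sub_add_cancel]
    rw [this]
    exact Subalgebra.add_mem _ hmem' (Subalgebra.mul_mem _ (Subalgebra.algebraMap_mem _ c) hμmem)

/-- **Clearing the poles off `S`**: for an `S`-invariant `z ≠ 0` there is a non-zero `S`-invariant
`d ∈ K̄[X]` (a product of powers of `X - X(P)` over the poles `P ∉ S` of `z`) with `d z` regular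
off `S`. [folklore] -/
theorem exists_mul_regular_off {z : W.geomFunctionField} (hz : z ≠ 0) :
    ∃ d : W.geomFunctionField, d ≠ 0 ∧ d ∈ Algebra.adjoin (AlgebraicClosure K) {W.quotX S hS, W.quotY S hS} ∧
      (∀ s ∈ S, W.transAlgHom s d = d) ∧
      ∀ P : W.geomPoints, P ∉ S → placeValuation (W.baseChange (AlgebraicClosure K)).toAffine P (d * z) ≤ 1 := by
  -- the poles of `z` off `S`
  have hfin : {P : W.geomPoints | P ∉ S ∧ ord (W.baseChange (AlgebraicClosure K)).toAffine P z < 0}.Finite := by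
    refine (finite_support_ord (V := (W.baseChange (AlgebraicClosure K)).toAffine) hz).subset fun P hP ↦ ?_
    have hP' : P ∉ S ∧ ord (W.baseChange (AlgebraicClosure K)).toAffine P z < 0 := hP
    change ord _ P z ≠ 0
    omega
  set poles := hfin.toFinset with hpoles
  -- the value of `X` at `P ∉ S`
  set xval : W.geomPoints → AlgebraicClosure K := fun P ↦ W.relCoeff hS 0 * ∑ s ∈ hS.toFinset, xy (P + s) 0
  set fac : W.geomPoints → W.geomFunctionField := fun P ↦
    W.quotX S hS - algebraMap (AlgebraicClosure K) W.geomFunctionField (xval P) with hfac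
  have hXconst : ∀ c : AlgebraicClosure K, W.quotX S hS ≠ algebraMap (AlgebraicClosure K) W.geomFunctionField c :=
    fun c h ↦ transcendental_quotX hS (h ▸ isAlgebraic_algebraMap c)
  have hfac0 : ∀ P, fac P ≠ 0 := fun P h ↦ hXconst _ (sub_eq_zero.mp h)
  have hfacinv : ∀ P, ∀ s ∈ S, W.transAlgHom s (fac P) = fac P := fun P s hs ↦ by
    simp only [hfac, map_sub, AlgHom.commutes, transAlgHom_quotX hS hs]
  have hfacreg : ∀ P Q : W.geomPoints, Q ∉ S →
      placeValuation (W.baseChange (AlgebraicClosure K)).toAffine Q (fac P) ≤ 1 := fun P Q hQ ↦ by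
    refine (Valuation.map_sub _ _ _).trans (max_le (placeValuation_quotX_le_one hS hQ) ?_)
    by_cases h0 : xval P = 0
    · simp [h0]
    · exact (placeValuation_algebraMap Q h0).le
  have hfacpos : ∀ P : W.geomPoints, P ∉ S →
      1 ≤ ord (W.baseChange (AlgebraicClosure K)).toAffine P (fac P) := fun P hP ↦
    (hasValueAt_quotX hS hP).ord_sub_algebraMap_pos (fun h ↦ hP (h ▸ S.zero_mem)) (hXconst _)
  -- `d = ∏_{P ∈ poles} fac P ^ (-ord_P z)`
  set d := ∏ P ∈ poles, fac P ^ (-ord (W.baseChange (AlgebraicClosure K)).toAffine P z).toNat with hd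
  have hd0 : d ≠ 0 := Finset.prod_ne_zero_iff.mpr fun P _ ↦ pow_ne_zero _ (hfac0 P)
  refine ⟨d, hd0, ?_, ?_, ?_⟩
  · rw [hd]
    refine Subalgebra.prod_mem _ fun P _ ↦ Subalgebra.pow_mem _ ?_ _
    exact Subalgebra.sub_mem _ (Algebra.subset_adjoin (by simp)) (Subalgebra.algebraMap_mem _ _)
  · intro s hs
    rw [hd, map_prod]
    exact Finset.prod_congr rfl fun P _ ↦ by rw [map_pow, hfacinv P s hs]
  · intro Q hQ
    rw [placeValuation_le_one_iff_ord_nonneg Q (mul_ne_zero hd0 hz), ord_mul Q hd0 hz, hd,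
      ord_finset_prod poles (fun P _ ↦ pow_ne_zero _ (hfac0 P)) Q]
    simp_rw [ord_pow _ (hfac0 _)]
    have hterm : ∀ P ∈ poles, (0 : ℤ) ≤ ((-ord (W.baseChange (AlgebraicClosure K)).toAffine P z).toNat : ℕ) *
        ord (W.baseChange (AlgebraicClosure K)).toAffine Q (fac P) := fun P _ ↦
      mul_nonneg (by positivity) ((placeValuation_le_one_iff_ord_nonneg Q (hfac0 P)).mp (hfacreg P Q hQ))
    by_cases hQpoles : Q ∈ poles
    · have hsingle := Finset.single_le_sum hterm hQpoles
      have hQ' : Q ∉ S ∧ ord (W.baseChange (AlgebraicClosure K)).toAffine Q z < 0 := by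
        rw [hpoles, Set.Finite.mem_toFinset] at hQpoles; exact hQpoles
      have h1 := hfacpos Q hQ
      have hcast : (((-ord (W.baseChange (AlgebraicClosure K)).toAffine Q z).toNat : ℕ) : ℤ) =
          -ord (W.baseChange (AlgebraicClosure K)).toAffine Q z := Int.toNat_of_nonneg (by omega)
      nlinarith
    · have hQ' : 0 ≤ ord (W.baseChange (AlgebraicClosure K)).toAffine Q z := by
        by_contra hneg
        exact hQpoles (by rw [hpoles, Set.Finite.mem_toFinset]; exact ⟨hQ, by omega⟩)
      have := Finset.sum_nonneg hterm
      omega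

/-- **Galois correspondence for `K̄(E)/K̄(E)^S`: every `S`-invariant function is a rational
function of `X, Y`** — `K̄(E)^S = K̄(X, Y)`, i.e. `φ^* K̄(E/S)` is the full fixed field.
Silverman, *AEC*, Thm. III.4.10(b) for this `φ` (`φ^* K̄(E₂) = K̄(E₁)^{ker φ}` for separable
`φ`). [folklore] -/
theorem mem_adjoin_of_invariant {z : W.geomFunctionField} (hinv : ∀ s ∈ S, W.transAlgHom s z = z) :
    z ∈ IntermediateField.adjoin (AlgebraicClosure K) {W.quotX S hS, W.quotY S hS} := by
  rcases eq_or_ne z 0 with rfl | hz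
  · exact zero_mem _
  obtain ⟨d, hd0, hdA, hdinv, hdreg⟩ := exists_mul_regular_off hS hz
  have hdzinv : ∀ s ∈ S, W.transAlgHom s (d * z) = d * z := fun s hs ↦ by
    rw [map_mul, hdinv s hs, hinv s hs]
  have hdz : d * z ∈ Algebra.adjoin (AlgebraicClosure K) {W.quotX S hS, W.quotY S hS} :=
    mem_adjoin_of_invariant_of_regular hS
      (-ord (W.baseChange (AlgebraicClosure K)).toAffine (0 : W.geomPoints) (d * z)).toNat (d * z) hdzinv hdreg
      (Or.inr (by omega))
  have hle := IntermediateField.algebra_adjoin_le_adjoin (AlgebraicClosure K)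
    ({W.quotX S hS, W.quotY S hS} : Set W.geomFunctionField)
  have : z = d * z / d := by field_simp
  rw [this]
  exact div_mem (hle hdz) (hle hdA)

variable [PerfectField K]
variable (hstab : ∀ (σ : Field.absoluteGaloisGroup K) (P : W.geomPoints), P ∈ S → σ • P ∈ S)

/-- **`φ^* x' = X`** for the quotient isogeny (both have the value `x'(φ P)` at almost every
`P`). [folklore] -/
theorem pullbackX_quotIsogeny : (W.quotIsogeny S hS hstab).pullbackX = W.quotX S hS := by
  apply eq_of_infinite_setOf_hasValueAt
  have hsub : ((S : Set W.geomPoints) ∪ (W.quotIsogeny S hS hstab).badSet)ᶜ ⊆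
      {P : W.geomPoints | P ≠ 0 ∧ ∃ c, W.HasValueAt (W.quotIsogeny S hS hstab).pullbackX P c ∧
        W.HasValueAt (W.quotX S hS) P c} := by
    intro P hP
    simp only [Set.mem_compl_iff, Set.mem_union, SetLike.mem_coe, not_or, Isogeny.badSet, Set.mem_setOf_eq,
      not_not] at hP
    obtain ⟨hPS, hA⟩ := hP
    have hP0 : P ≠ 0 := fun h ↦ hPS (h ▸ S.zero_mem)
    refine ⟨hP0, xy (W.quotIsogeny S hS hstab P) 0, ?_, ?_⟩
    · exact (W.quotIsogeny S hS hstab).rationalRep.hasValueAt_pullbackX hA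
    · rw [quotIsogeny_apply, (xy_quotFun hS hstab hPS).2.1]
      exact hasValueAt_quotX hS hPS
  exact ((hS.union (W.quotIsogeny S hS hstab).finite_badSet').infinite_compl).mono hsub

/-- **`φ^* y' = Y`** for the quotient isogeny. [folklore] -/
theorem pullbackY_quotIsogeny : (W.quotIsogeny S hS hstab).pullbackY = W.quotY S hS := by
  apply eq_of_infinite_setOf_hasValueAt
  have hsub : ((S : Set W.geomPoints) ∪ (W.quotIsogeny S hS hstab).badSet)ᶜ ⊆
      {P : W.geomPoints | P ≠ 0 ∧ ∃ c, W.HasValueAt (W.quotIsogeny S hS hstab).pullbackY P c ∧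
        W.HasValueAt (W.quotY S hS) P c} := by
    intro P hP
    simp only [Set.mem_compl_iff, Set.mem_union, SetLike.mem_coe, not_or, Isogeny.badSet, Set.mem_setOf_eq,
      not_not] at hP
    obtain ⟨hPS, hA⟩ := hP
    have hP0 : P ≠ 0 := fun h ↦ hPS (h ▸ S.zero_mem)
    refine ⟨hP0, xy (W.quotIsogeny S hS hstab P) 1, ?_, ?_⟩
    · exact (W.quotIsogeny S hS hstab).rationalRep.hasValueAt_pullbackY hA
    · rw [quotIsogeny_apply, (xy_quotFun hS hstab hPS).2.2]
      exact hasValueAt_quotY hS hPS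
  exact ((hS.union (W.quotIsogeny S hS hstab).finite_badSet').infinite_compl).mono hsub

/-- **`deg φ = #S`** for the quotient isogeny `φ : E → E/S` (`deg φ = [K̄(E) : φ^* K̄(E/S)]`, the
tree's `Isogeny.deg`): `#S = #ker φ ∣ deg φ` (tree's III.4.10(b), `card_ker_dvd_deg_holds`), and
`φ^* K̄(E/S) = K̄(X, Y) ⊇ K̄(E)^S` (`mem_adjoin_of_invariant`) has index dividing
`[K̄(E) : K̄(E)^S] = #S` (Artin). Hence `φ` is separable of degree `#S`. Silverman, *AEC*,
Thm. III.4.10(a),(c) and Prop. III.4.12. [cite: SilvermanAEC2009, Prop. III.4.12] -/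
theorem deg_quotIsogeny : (W.quotIsogeny S hS hstab).deg = Nat.card S := by
  set φ := W.quotIsogeny S hS hstab with hφ
  -- `#S ∣ deg φ`
  have h1 : Nat.card S ∣ φ.deg := by
    have := φ.card_ker_dvd_deg_holds
    rwa [ker_quotIsogeny] at this
  -- the subgroup of translations by `S` and Artin's theorem
  set H : Subgroup (W.geomFunctionField ≃ₐ[AlgebraicClosure K] W.geomFunctionField) :=
    (AddSubgroup.toSubgroup S).map W.transHom with hH
  have hcardK : Nat.card (AddSubgroup.toSubgroup S) = Nat.card S :=
    Nat.card_congr (Equiv.subtypeEquiv Multiplicative.toAdd fun _ ↦ Iff.rfl)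
  have hcard : Nat.card H = Nat.card S := by
    rw [hH, Subgroup.card_map_of_injective transHom_injective, hcardK]
  haveI : Finite S := hS.to_subtype
  haveI : Finite (AddSubgroup.toSubgroup S) := Nat.finite_of_card_ne_zero (by
    rw [hcardK]; exact (Nat.card_pos (α := S)).ne')
  haveI : Finite H := by
    rw [hH]
    exact Finite.of_surjective _ (Subgroup.equivMapOfInjective _ _ transHom_injective).surjective
  letI : Fintype H := Fintype.ofFinite H
  have hfix : Module.finrank (IntermediateField.fixedField H) W.geomFunctionField = Nat.card S := by
    have h0 : Module.finrank (IntermediateField.fixedField H) W.geomFunctionField = Fintype.card H :=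
      FixedPoints.finrank_eq_card H W.geomFunctionField
    rw [h0, ← Nat.card_eq_fintype_card, hcard]
  -- `K̄(E)^S ≤ φ^* K̄(E/S)`
  have hle : IntermediateField.fixedField H ≤ φ.pullbackField := by
    intro z hz
    rw [IntermediateField.mem_fixedField_iff] at hz
    have hinv : ∀ s ∈ S, W.transAlgHom s z = z := fun s hs ↦ by
      have := hz (W.transHom (Multiplicative.ofAdd s)) (Subgroup.mem_map_of_mem _ (by simpa using hs))
      simpa using this
    change z ∈ IntermediateField.adjoin _ {φ.pullbackX, φ.pullbackY}
    rw [hφ, pullbackX_quotIsogeny, pullbackY_quotIsogeny]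
    exact mem_adjoin_of_invariant hS hinv
  have h2 : φ.deg ∣ Nat.card S := by
    rw [← hfix]; exact IntermediateField.finrank_dvd_of_le_left hle
  exact Nat.dvd_antisymm h2 h1

end Degree

end WeierstrassCurve


/-! ## The named facts discharged -/

namespace WeierstrassCurve

open _root_.WeierstrassCurve.geomPoints Literature.NumberTheory.EllipticCurves.WeierstrassFunctionField

variable {K : Type u} [Field K] (W : WeierstrassCurve K)

/-- **Silverman, *AEC*, Prop. III.4.12 with Rem. III.4.13.2 and Thm. III.4.10(a) and (c) — the
separable quotient isogeny, proved**: the named fact `WeierstrassCurve.exists_separable_isogeny_ker_eq W`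
of `IsogenyQuotientProofs` holds. For `K` perfect, `E = W` elliptic and `S ⊆ E(K̄)` a finite
`Γ_K`-stable subgroup, the curve `E/S = W.quotCurve S` over `K` is elliptic and
`φ = W.quotIsogeny S : E → E/S` is an isogeny over `K` with `ker φ = S` and `deg φ = #S`.
[cite: SilvermanAEC2009, Prop. III.4.12] -/
theorem exists_separable_isogeny_ker_eq_holds : W.exists_separable_isogeny_ker_eq := by
  intro _ _ S hS hstab
  exact ⟨W.quotCurve S hS hstab, isElliptic_quotCurve hS hstab, W.quotIsogeny S hS hstab,
    ker_quotIsogeny hS hstab, deg_quotIsogeny hS hstab⟩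

/-- **The quotient isogeny together with its dual, proved**: the named fact
`WeierstrassCurve.exists_isogeny_ker_eq_and_comp_eq_nsmul W` of `IsogenyQuotient` (Silverman,
*AEC*, Prop. III.4.12, Rem. III.4.13.2, Thm. III.6.1(a), Thm. III.6.2(a): `g : E → E/S` with
`ker g = S` and `f : E/S → E` with `f ∘ g = [#S]`, `g ∘ f = [#S]`) holds — the geometric input
`hquot` of Tate's theorem for elliptic curves over finite fields
(`Literature.AlgebraicGeometry.Motives.FaltingsECTateMainTheoremProofs`). The dual is supplied by
the tree's `exists_isogeny_ker_eq_and_comp_eq_nsmul_of_separable_quotient` (Cor. III.4.11 and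
Thm. II.2.3, `IsogenySeparableFactorProofs`). [cite: SilvermanAEC2009, Prop. III.4.12 with Thm. III.6.1(a)] -/
theorem exists_isogeny_ker_eq_and_comp_eq_nsmul_holds : W.exists_isogeny_ker_eq_and_comp_eq_nsmul :=
  exists_isogeny_ker_eq_and_comp_eq_nsmul_of_separable_quotient (exists_separable_isogeny_ker_eq_holds W)

end WeierstrassCurve
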